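import Literature.MathematicalPhysics.QuantumFieldTheory.Balaban1983to89.T4CouplingDomination

/-!
# T⁴ pure Yang–Mills, NE1′ (O3b/H2) — `T4CouplingVariance`: the VARIANCE COLLAPSE of the coupling line.
# The fluctuation half of the dressed-stability estimate, in the first-moment channel every end-to-end theorem of
# the lineage uses, follows from ONE NUMBER — the mean-square distance, under the UNDRESSED path law, between the
# unit-scale observable and ANY function of the unit-lattice endpoint — and so does the integrated mean channel

HONEST FRAMING.  This file is MEASURE THEORY (kernel-checked folklore; every declaration is tagged [folklore]).  It
concerns the finite-volume T⁴ renormalisation-group tower of [Balaban1983to89] only through the DICTIONARY below; it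
asserts NO printed statement, proves NO estimate of the programme, and is NOT progress on the Clay Millennium problem
(finite T⁴ only; no infinite volume, no mass gap, no reconstruction).  Its consumer — node NE1′ of the cell's T⁴
ladder, rung (B)+1 — stays CONDITIONAL on the printed inputs named `BetaPertH`, `(B)`, `(B^μ)` in the cell records,
none of which is touched here; nothing of them is hidden in a definition (there is no `def` of a `Prop` in this file).
The value of the file is a TYPED COLLAPSE: after it, what the lineage's organisation of NE1′ needs from the programme
is ONE displayed second moment (MI-V below), of which the structured hypotheses (O)/(O″)+(P)/(J)/(L)/(N) of
`T4CouplingDomination` are ONE sufficient decomposition and the per-step ladder of §3 is another.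

CITATION HEADER.  Nothing is cited from the manuscripts under audit; no Literature fact (`def … : Prop`) is introduced
or consumed.  The only import is the cell's own kernel-checked module `T4CouplingDomination` (hence `T4CouplingChain`,
`T4PathwiseCoupling`, `T4MeanChannel` and Mathlib's conditional-expectation / Ionescu–Tulcea / disintegration API).
The abstract facts of §1 are textbook Hilbert-space geometry of conditional expectation (orthogonality of
`f − μ[f|m]` to `L²(m)`, Pythagoras, Minkowski) and are RE-PROVED here over Mathlib, not cited; the ten-line
exp-Lipschitz lemma `abs_exp_mul_sub_exp_mul_le` is re-proved locally (rather than imported from the cell's `T4BoundaryRate` /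
`T4VarianceMatching`, which would drag the NE7/P3 apex chain into this leaf's import cone).

## Position in the lineage (record `t4/T4-EST-NE1p-P2.md`, §5)

`T4CouplingChain.integral_mul_exp_le_condVar(_of_pathLaw)` isolated the fluctuation half of NE1′ as a tail bound for
the ACCUMULATED ONE-STEP CONDITIONAL VARIANCES `S := Σ_{b<n} oneStepVar κ b φ (x≤b)` of the conditional means of the
unit-scale observable `φ` along the backward presentation of the chain (`X 0` = unit-lattice endpoint, slot `b+1` =
the data revealed one refinement below slot `b`, `κ b` = one-step fibre kernel; for standard Borel carriers every
finite path law `μ` is the realised chain of its posterior kernels).  Every end-to-end theorem since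
(`T4PathwiseCoupling` §4b, `T4CouplingDomination` §3–§4) bounds that tail by MARKOV through `Σ_b ∫ W b (x≤b) dμ` for
majorants `W b ≥ oneStepVar κ b φ` a.e., and the structured hypotheses (O), (O″)+(P), (J), (L), (N) of
`T4CouplingDomination` serve only to bound those first moments.  This module takes `W b := oneStepVar κ b φ` itself:

* §1 ABSTRACT `L²` GEOMETRY OF CONDITIONAL EXPECTATION (finite measure space).  `integral_sq_sub_eq_add_of_condExp`:
  for bounded `f` and bounded `m`-measurable `Z`, `∫ (f − Z)² = ∫ (f − μ[f|m])² + ∫ (μ[f|m] − Z)²` (the cross term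
  vanishes through the mean channel `T4MeanChannel.integral_mul_eq_zero_of_condExp_ae_eq_zero`); hence the conditional
  mean is the `L²`-closest `m`-measurable function (`integral_sq_sub_condExp_le`) and an `L²`-contraction towards any
  `m`-measurable centre (`integral_sq_condExp_sub_le`); with `Z = 0` the COHERENT/INCOHERENT split
  `∫ f² = ∫ (f − μ[f|m])² + ∫ μ[f|m]²` (`integral_sq_eq_add_sq_condExp`); along an antitone filtration the incoherent
  part is the sum of the squared Doob increments (`T4MeanChannel.integral_sq_condExp_sub_eq_sum`), so a.e. bounds
  `|incr_i| ≤ c i` give `∫ (f − μ[f|F p])² ≤ Σ_{i<p} ∫ (c i)²` (`integral_sq_sub_condExp_le_sum_of_incr_le`: the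
  bounded-differences variance bound in filtration form); Minkowski in `L²` for bounded functions
  (`sqrt_integral_sq_add_le`, `sqrt_integral_sq_sum_le`) and the LADDER inequality
  `‖f − ψ 0‖₂ ≤ Σ_{b<n} ‖ψ (b+1) − ψ b‖₂ + ‖f − ψ n‖₂` (`sqrt_integral_sq_sub_le_ladder`).
* §2 THE VARIANCE IDENTITY ON THE CHAIN.  `sum_integral_oneStepVar_eq`: for a bounded `piLE n`-measurable `φ`,
  `Σ_{b<n} ∫ oneStepVar κ b φ (x≤b) dμ = ∫ (φ − towerMean κ φ (x 0))² dμ` (`μ = trajMeasure ν κ`): the accumulated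
  one-step conditional variances integrate to the CONDITIONAL VARIANCE OF `φ` GIVEN THE ENDPOINT (orthogonality of the
  Doob increments, `T4MeanChannel.integral_sq_condExp_sub_eq_sum`, with the identifications
  `T4CouplingChain.condExp_incr_sq_frame_ae_eq` / `condExp_endpoint_ae_eq_towerMean`); `…_pathLaw`: the same for an
  arbitrary finite path law and its posterior kernels.  `integral_sq_sub_towerMean_le`: `∫ (φ − towerMean κ φ (x 0))² dμ
  ≤ ∫ (φ − Z (x 0))² dμ` for EVERY bounded measurable endpoint function `Z`; `integral_sq_towerMean_sub_le`:
  `∫ (towerMean κ φ − Z)² dν ≤ ∫ (φ − Z (x 0))² dμ` (the mean channel is `L²`-dominated by the same number).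
* §3 END-TO-END FROM ONE NUMBER (realised chain `μ = trajMeasure ν κ`).  `integral_mul_exp_le_of_condVariance`:
  `|φ| ≤ R` `piLE n`-measurable, `|t|·2R ≤ 1`, `0 ≤ g₀ ≤ Cg` measurable, `B > 0`, and
  `∫ (φ − towerMean κ φ (x 0))² dμ ≤ 𝒱` ⇒ `∫ g₀(x 0) e^{tφ} dμ ≤ e^{t²B}·∫ g₀ e^{t·towerMean κ φ} dν + e^{|t|R}·Cg·B⁻¹·𝒱`
  (`T4CouplingChain.integral_mul_exp_le_condVar` + Markov on the accumulated one-step variances + §2);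
  `integral_mul_exp_le_of_sqDefect`: the same from `∫ (φ − Z (x 0))² dμ ≤ 𝒱` for any bounded measurable `Z`.
  THE MEAN CHANNEL from the same number: `abs_integral_mul_exp_towerMean_sub_exp_le`
  (`|∫ g₀ (e^{t·towerMean κ φ} − e^{tZ}) dν| ≤ |t|·e^{|t|R}·Cg·√(ν(univ))·√(∫ (φ − Z (x 0))² dμ)`, from the local
  exp-Lipschitz lemma `abs_exp_mul_sub_exp_mul_le` and Cauchy–Schwarz), conditional Jensen in chain form
  (`integral_mul_exp_towerMean_le`), and the TWO-SIDED comparison of the dressed endpoint integrals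
  `∫ g₀(x 0) e^{tφ} dμ` with the NAIVELY REWEIGHTED undressed ones `∫ g₀ e^{tZ} dν`
  (`integral_mul_exp_naive_le_add`, `integral_mul_exp_le_naive_of_sqDefect`): they agree up to
  `O(|t|𝒱^{1/2} + t²B + B⁻¹𝒱)` with every constant displayed.  THE LADDER: for predictable centres `Zb b (x≤b)`
  (bounded measurable functions of the length-`b` history) with per-step mean-square increments
  `∫ (Zb (b+1) (x≤(b+1)) − Zb b (x≤b))² dμ ≤ (a b)²` (`b < n`) and a last rung `∫ (φ − Zb n (x≤n))² dμ ≤ (a n)²`: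
  `∫ (φ − Zb 0 (x≤0))² dμ ≤ (Σ_{b≤n} a b)²` (`integral_sq_sub_le_sq_sum_of_ladder`, any finite law on paths) and the
  end-to-end bound with `𝒱 = (Σ_{b≤n} a b)²` (`integral_mul_exp_le_of_ladder`) — the one number is bounded by the
  square of a SUM OF PER-STEP `L²` SIZES, with no orthogonality or decorrelation BETWEEN steps required.
* §4 THE CONSUMABLE FORMS FOR AN ARBITRARY FINITE PATH LAW `μ` on `Π n, X n` (standard Borel non-empty carriers,
  `κ := posteriorKernel μ`, `T4CouplingChain.trajMeasure_posteriorKernel_eq`): `sum_integral_oneStepVar_eq_pathLaw`,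
  `integral_sq_sub_towerMean_le_pathLaw`, `integral_mul_exp_le_of_sqDefect_pathLaw` (MI-V form),
  `integral_mul_exp_naive_bounds_pathLaw` (both sides against `e^{tZ(x 0)}·μ`), `integral_mul_exp_le_of_ladder_pathLaw`
  (MI-Δ form).
* §5 (v2) MI-V IN ONE-STEP SECOND-MOMENT CURRENCY WITH FREE PREDICTABLE CENTRES: the one-step variance about the
  conditional mean is the least one-step second moment about any constant (`oneStepVar_le_integral_sq_sub_const`),
  whence for ANY bounded measurable centres `ctr b : (levels ≤ b) → ℝ`
  `∫ (φ − towerMean κ φ (x 0))² dμ ≤ Σ_{b<n} ∫ [∫ (fiberMean κ (b+1) φ u − ctr b (x≤b))² d(partialTraj κ b (b+1) (x≤b))(u)] dμ`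
  (`integral_sq_sub_towerMean_le_sum_oneStepSqDev`, `_pathLaw`), and the end-to-end bounds from that sum
  (`integral_mul_exp_le_of_oneStepSqDev`, `_pathLaw`): MI-V is fed by ONE-STEP second moments — under one draw of the
  fresh level from the conditional law — of the deviation of the new conditional mean from the consumer's proxy, with
  no conditional ranks, product domination or factorisation hypothesis.

## DICTIONARY and the exact remaining hypothesis (nothing below is proved or cited)

For the undressed path law `μ = μ_K` of the printed chain presented backward (`x 0 = V_K` the unit-lattice field,
`x b = ` the level-`(K−b)` data), the unit-scale observable `φ = W_C(avg^K V_0)` (the loop of the `K`-fold block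
average of the finest field, `|φ| ≤ R`), the natural endpoint function `Z = W_C` (the loop of the unit-lattice field
itself) and the natural ladder `Zb b (x≤b) = W_C(avg^b V_{K−b})` (the loop of the `b`-fold block average of the
level-`(K−b)` field; `Zb K = φ`, `Zb 0 = Z ∘ (· 0)`), §3 says: the endpoint-conditioned exponential-moment comparison
of NE1′ — dressed law `e^{tφ}·μ` restricted to the unit lattice versus `e^{tW_C}·ρ_K` — holds with constants free of
`K` as soon as
(MI-V)  `𝒱_K := ∫ (W_C(avg^K V_0) − W_C(V_K))² dμ_K ≤ 𝒱_tot`  uniformly in `K`,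
equivalently (up to the square of a sum) as soon as the PER-STEP mean-square effects of the single large-field
operations on the unit-scale loop, `a_b² := ∫ (W_C(avg^{b+1} V_{K−b−1}) − W_C(avg^b V_{K−b}))² dμ_K` — under the chain,
`avg^b V_{K−b}` and `avg^{b+1} V_{K−b−1}` differ exactly by the `b`-fold average of (resampled − unresampled) level-
`(K−b)` configuration of ONE ℝ-step — have `Σ_b a_b ≤ A` uniformly in `K`.  By §1's coherent/incoherent split each
`a_b²` is the sum of (inc) the expected conditional variance of that effect given the pre-step configuration — under
conditional independence of the fresh small-field samples on distinct components, a sum of squared per-component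
bounded differences, i.e. SECOND moments of component sizes at the resampled bonds under the tube weighted by the
squared averaging sensitivity of the unit loop — and (coh) the mean square of its conditional mean given the pre-step
configuration — a CONNECTED PAIR CORRELATION of large-field-supported local functionals under the effective density of
that level.  Neither (inc) nor (coh) nor (MI-V) is printed, proved or cited here; the record §5 «KERNEL FORM AFTER
T4CouplingVariance» states them as the exact missing inequalities, and explains why the pathwise / first-moment
radii of (O″)+(P) cannot be instantiated for typical paths while these second moments can (first moments of the
within-tube resampled volume weighted by the LINEAR sensitivity diverge in the depth; second moments weighted by the
SQUARED sensitivity converge).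

## What this file does NOT do

It does not define the printed densities, averaging maps or kernels; it does not prove or cite (MI-V), (inc), (coh)
for them; it does not treat infinite volume or any continuum / mass-gap statement; the mean channel enters only in
its integrated `L²` form (the β-function node's pointwise statement MI-3 is untouched).
-/

noncomputable section

open MeasureTheory ProbabilityTheory Finset Preorder Function
open scoped ProbabilityTheory ENNReal

namespace Literature.MathematicalPhysics.QuantumFieldTheory.Balaban1983to89.T4CouplingVariance

open MeasureTheory.Filtration
open Literature.MathematicalPhysics.QuantumFieldTheory.Balaban1983to89.T4MeanChannel
open Literature.MathematicalPhysics.QuantumFieldTheory.Balaban1983to89.T4PathwiseCoupling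
open Literature.MathematicalPhysics.QuantumFieldTheory.Balaban1983to89.T4CouplingChain
open Literature.MathematicalPhysics.QuantumFieldTheory.Balaban1983to89.T4CouplingDomination

/-! ## §1  Abstract `L²` geometry of conditional expectation on a finite measure space -/

section LTwo

variable {Ω : Type*} {m mΩ : MeasurableSpace Ω} {μ : Measure Ω} [IsFiniteMeasure μ]

omit [IsFiniteMeasure μ] in
/-- [folklore] Re-indexing a sum over frame steps by chain slots: `Σ_{i<n} a (n−(i+1)) = Σ_{b<n} a b`. -/
theorem sum_range_reflect_succ {M : Type*} [AddCommMonoid M] (a : ℕ → M) (n : ℕ) :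
    ∑ i ∈ range n, a (n - (i + 1)) = ∑ b ∈ range n, a b := by
  rw [← Finset.sum_range_reflect a n]
  refine Finset.sum_congr rfl fun i hi => ?_
  have : n - 1 - i = n - (i + 1) := by omega
  rw [this]

/-- [folklore] **PYTHAGORAS AT A SUB-σ-ALGEBRA.**  For a bounded measurable `f` and a bounded `m`-measurable centre
`Z`: `∫ (f − Z)² dμ = ∫ (f − μ[f|m])² dμ + ∫ (μ[f|m] − Z)² dμ` — the residual `f − μ[f|m]` is orthogonal to every
bounded `m`-measurable function (mean channel). -/
theorem integral_sq_sub_eq_add_of_condExp (hm : m ≤ mΩ) {f : Ω → ℝ} (hfm : StronglyMeasurable f) {R : ℝ}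
    (hfR : ∀ ω, |f ω| ≤ R) {Z : Ω → ℝ} (hZm : StronglyMeasurable[m] Z) {CZ : ℝ} (hZb : ∀ ω, |Z ω| ≤ CZ) :
    ∫ ω, (f ω - Z ω) ^ 2 ∂μ =
      ∫ ω, (f ω - μ[f|m] ω) ^ 2 ∂μ + ∫ ω, (μ[f|m] ω - Z ω) ^ 2 ∂μ := by
  haveI : SigmaFinite (μ.trim hm) := inferInstance
  set c : Ω → ℝ := μ[f|m] with hc
  have hcb : ∀ᵐ ω ∂μ, |c ω| ≤ R := ae_abs_condExp_le hfR
  have hfi : Integrable f μ := integrable_of_abs_le_const hfm hfR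
  have hZi : Integrable Z μ := integrable_of_abs_le_const (hZm.mono hm) hZb
  have hci : Integrable c μ := integrable_condExp
  have hcm : StronglyMeasurable[m] c := stronglyMeasurable_condExp
  -- integrability of the three pieces
  have hA : Integrable (fun ω => (f ω - c ω) ^ 2) μ :=
    integrable_sq_of_ae_abs_le (hfi.aestronglyMeasurable.sub hci.aestronglyMeasurable) (bu := R + R)
      (by filter_upwards [hcb] with ω hω; exact (abs_sub _ _).trans (add_le_add (hfR ω) hω))
  have hB : Integrable (fun ω => (c ω - Z ω) ^ 2) μ :=
    integrable_sq_of_ae_abs_le (hci.aestronglyMeasurable.sub hZi.aestronglyMeasurable) (bu := R + CZ)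
      (by filter_upwards [hcb] with ω hω; exact (abs_sub _ _).trans (add_le_add hω (hZb ω)))
  have hX : Integrable (fun ω => (c ω - Z ω) * (f ω - c ω)) μ := by
    refine integrable_of_ae_abs_le ((hci.aestronglyMeasurable.sub hZi.aestronglyMeasurable).mul
      (hfi.aestronglyMeasurable.sub hci.aestronglyMeasurable)) (bu := (R + CZ) * (R + R)) ?_
    filter_upwards [hcb] with ω hω
    have h1 : |c ω - Z ω| ≤ R + CZ := (abs_sub _ _).trans (add_le_add hω (hZb ω))
    have h2 : |f ω - c ω| ≤ R + R := (abs_sub _ _).trans (add_le_add (hfR ω) hω)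
    show |(c ω - Z ω) * (f ω - c ω)| ≤ (R + CZ) * (R + R)
    rw [abs_mul]
    exact mul_le_mul h1 h2 (abs_nonneg _) ((abs_nonneg _).trans h1)
  -- the cross term vanishes: `μ[f − c | m] = 0` a.e. and `c − Z` is `m`-measurable
  have h0 : μ[fun ω => f ω - c ω | m] =ᵐ[μ] 0 := by
    have hfc : (fun ω => f ω - c ω) = f - c := rfl
    have hcc : μ[c|m] = c := condExp_of_stronglyMeasurable hm hcm hci
    rw [hfc]
    filter_upwards [condExp_sub hfi hci m] with ω hω
    rw [hω, Pi.sub_apply, hcc, Pi.zero_apply, sub_self]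
  have hcross : ∫ ω, (c ω - Z ω) * (f ω - c ω) ∂μ = 0 :=
    integral_mul_eq_zero_of_condExp_ae_eq_zero hm (hcm.sub hZm) (hfi.sub hci) hX h0
  have hexp : (fun ω => (f ω - Z ω) ^ 2) =
      fun ω => ((f ω - c ω) ^ 2 + (c ω - Z ω) ^ 2) + 2 * ((c ω - Z ω) * (f ω - c ω)) := by
    funext ω; ring
  have hAB : Integrable (fun ω => (f ω - c ω) ^ 2 + (c ω - Z ω) ^ 2) μ := hA.add hB
  rw [hexp, integral_add hAB (hX.const_mul 2), integral_add hA hB, integral_const_mul, hcross,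
    mul_zero, add_zero]

/-- [folklore] **The conditional mean is the `L²`-closest `m`-measurable function**:
`∫ (f − μ[f|m])² dμ ≤ ∫ (f − Z)² dμ` for every bounded `m`-measurable `Z`. -/
theorem integral_sq_sub_condExp_le (hm : m ≤ mΩ) {f : Ω → ℝ} (hfm : StronglyMeasurable f) {R : ℝ}
    (hfR : ∀ ω, |f ω| ≤ R) {Z : Ω → ℝ} (hZm : StronglyMeasurable[m] Z) {CZ : ℝ} (hZb : ∀ ω, |Z ω| ≤ CZ) :
    ∫ ω, (f ω - μ[f|m] ω) ^ 2 ∂μ ≤ ∫ ω, (f ω - Z ω) ^ 2 ∂μ := by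
  rw [integral_sq_sub_eq_add_of_condExp hm hfm hfR hZm hZb]
  exact le_add_of_nonneg_right (integral_nonneg fun _ => sq_nonneg _)

/-- [folklore] **`L²`-contraction of the conditional mean towards any `m`-measurable centre**:
`∫ (μ[f|m] − Z)² dμ ≤ ∫ (f − Z)² dμ`. -/
theorem integral_sq_condExp_sub_le (hm : m ≤ mΩ) {f : Ω → ℝ} (hfm : StronglyMeasurable f) {R : ℝ}
    (hfR : ∀ ω, |f ω| ≤ R) {Z : Ω → ℝ} (hZm : StronglyMeasurable[m] Z) {CZ : ℝ} (hZb : ∀ ω, |Z ω| ≤ CZ) :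
    ∫ ω, (μ[f|m] ω - Z ω) ^ 2 ∂μ ≤ ∫ ω, (f ω - Z ω) ^ 2 ∂μ := by
  rw [integral_sq_sub_eq_add_of_condExp hm hfm hfR hZm hZb]
  exact le_add_of_nonneg_left (integral_nonneg fun _ => sq_nonneg _)

/-- [folklore] **COHERENT / INCOHERENT SPLIT**: `∫ f² dμ = ∫ (f − μ[f|m])² dμ + ∫ μ[f|m]² dμ` — the second moment
of a one-step effect `f` is the expected conditional variance given the pre-step σ-algebra `m` (incoherent part)
plus the mean square of its conditional mean (coherent part). -/
theorem integral_sq_eq_add_sq_condExp (hm : m ≤ mΩ) {f : Ω → ℝ} (hfm : StronglyMeasurable f) {R : ℝ}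
    (hfR : ∀ ω, |f ω| ≤ R) :
    ∫ ω, f ω ^ 2 ∂μ = ∫ ω, (f ω - μ[f|m] ω) ^ 2 ∂μ + ∫ ω, μ[f|m] ω ^ 2 ∂μ := by
  have h := integral_sq_sub_eq_add_of_condExp (μ := μ) hm hfm hfR (Z := fun _ => (0 : ℝ))
    stronglyMeasurable_const (CZ := 0) (fun _ => by simp)
  simpa only [sub_zero] using h

/-- [folklore] **BOUNDED DIFFERENCES IN FILTRATION FORM.**  Along an antitone filtration `F 0 ⊇ … ⊇ F p`, for a
bounded `F 0`-measurable `f` whose Doob increments are a.e. dominated, `|incr μ F f i| ≤ c i` (`i < p`), by square-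
integrable functions `c i`: `∫ (f − μ[f|F p])² dμ ≤ Σ_{i<p} ∫ (c i)² dμ` (orthogonality of the increments,
`T4MeanChannel.integral_sq_condExp_sub_eq_sum`).  In the dictionary: `F p` = the pre-step configuration, `F i` reveals
the fresh samples of the components `> i`; under conditional independence of the components' fresh samples the
increment `i` is bounded by the oscillation of `f` in component `i`'s variables (McDiarmid's argument — NOT formalised
here; the bound `|incr| ≤ c` is the hypothesis). -/
theorem integral_sq_sub_condExp_le_sum_of_incr_le {F : ℕ → MeasurableSpace Ω} (hF : Antitone F)
    (hFle : ∀ j, F j ≤ mΩ) {f : Ω → ℝ} (hf0 : StronglyMeasurable[F 0] f) {R : ℝ} (hfR : ∀ ω, |f ω| ≤ R)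
    (p : ℕ) {c : ℕ → Ω → ℝ} (hci : ∀ i < p, Integrable (fun ω => c i ω ^ 2) μ)
    (hc : ∀ i < p, ∀ᵐ ω ∂μ, |incr μ F f i ω| ≤ c i ω) :
    ∫ ω, (f ω - μ[f|F p] ω) ^ 2 ∂μ ≤ ∑ i ∈ range p, ∫ ω, c i ω ^ 2 ∂μ := by
  haveI : SigmaFinite (μ.trim (hFle 0)) := inferInstance
  have hfi : Integrable f μ := integrable_of_abs_le_const (hf0.mono (hFle 0)) hfR
  have h := integral_sq_condExp_sub_eq_sum (μ := μ) hF hFle hfR 0 p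
  simp only [Nat.zero_add] at h
  rw [condExp_of_stronglyMeasurable (hFle 0) hf0 hfi] at h
  rw [h]
  refine Finset.sum_le_sum fun i hi => ?_
  have hi' := mem_range.mp hi
  refine integral_mono_ae ?_ (hci i hi') ?_
  · exact integrable_sq_of_ae_abs_le (aestronglyMeasurable_incr hF hFle f i) (ae_abs_incr_le hfR i)
  · filter_upwards [hc i hi'] with ω hω
    have h1 : |incr μ F f i ω| ^ 2 ≤ c i ω ^ 2 := pow_le_pow_left₀ (abs_nonneg _) hω 2
    simpa only [sq_abs] using h1

/-- [folklore] **MINKOWSKI in `L²` for bounded functions**: `√∫(u+v)² ≤ √∫u² + √∫v²`. -/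
theorem sqrt_integral_sq_add_le {u v : Ω → ℝ} (hum : AEStronglyMeasurable u μ) {bu : ℝ}
    (hub : ∀ᵐ ω ∂μ, |u ω| ≤ bu) (hvm : AEStronglyMeasurable v μ) {bv : ℝ} (hvb : ∀ᵐ ω ∂μ, |v ω| ≤ bv) :
    Real.sqrt (∫ ω, (u ω + v ω) ^ 2 ∂μ) ≤ Real.sqrt (∫ ω, u ω ^ 2 ∂μ) + Real.sqrt (∫ ω, v ω ^ 2 ∂μ) := by
  have hu2 : Integrable (fun ω => u ω ^ 2) μ := integrable_sq_of_ae_abs_le hum hub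
  have hv2 : Integrable (fun ω => v ω ^ 2) μ := integrable_sq_of_ae_abs_le hvm hvb
  have huv : Integrable (fun ω => u ω * v ω) μ := by
    refine integrable_of_ae_abs_le (hum.mul hvm) (bu := |bu| * |bv|) ?_
    filter_upwards [hub, hvb] with ω h1 h2
    show |u ω * v ω| ≤ |bu| * |bv|
    rw [abs_mul]
    exact mul_le_mul (h1.trans (le_abs_self _)) (h2.trans (le_abs_self _)) (abs_nonneg _) (abs_nonneg _)
  have hcs := abs_integral_mul_le_sqrt_mul_sqrt_of_integrable hu2 hv2 huv
  set A := Real.sqrt (∫ ω, u ω ^ 2 ∂μ) with hA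
  set Bv := Real.sqrt (∫ ω, v ω ^ 2 ∂μ) with hBv
  have hA0 : 0 ≤ A := Real.sqrt_nonneg _
  have hB0 : 0 ≤ Bv := Real.sqrt_nonneg _
  have hAA : A ^ 2 = ∫ ω, u ω ^ 2 ∂μ := Real.sq_sqrt (integral_nonneg fun _ => sq_nonneg _)
  have hBB : Bv ^ 2 = ∫ ω, v ω ^ 2 ∂μ := Real.sq_sqrt (integral_nonneg fun _ => sq_nonneg _)
  have hexp : (fun ω => (u ω + v ω) ^ 2) = fun ω => (u ω ^ 2 + v ω ^ 2) + 2 * (u ω * v ω) := by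
    funext ω; ring
  have hI : ∫ ω, (u ω + v ω) ^ 2 ∂μ = (∫ ω, u ω ^ 2 ∂μ + ∫ ω, v ω ^ 2 ∂μ) + 2 * ∫ ω, u ω * v ω ∂μ := by
    have huv2 : Integrable (fun ω => u ω ^ 2 + v ω ^ 2) μ := hu2.add hv2
    rw [hexp, integral_add huv2 (huv.const_mul 2), integral_add hu2 hv2, integral_const_mul]
  have hle : ∫ ω, (u ω + v ω) ^ 2 ∂μ ≤ (A + Bv) ^ 2 := by
    rw [hI, add_sq, hAA, hBB]
    have := le_abs_self (∫ ω, u ω * v ω ∂μ)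
    nlinarith [hcs, this]
  calc Real.sqrt (∫ ω, (u ω + v ω) ^ 2 ∂μ) ≤ Real.sqrt ((A + Bv) ^ 2) := Real.sqrt_le_sqrt hle
    _ = A + Bv := Real.sqrt_sq (add_nonneg hA0 hB0)

/-- [folklore] **MINKOWSKI for a finite sum**: `√∫(Σ_{b<n} d b)² ≤ Σ_{b<n} √∫(d b)²` for bounded `d b`. -/
theorem sqrt_integral_sq_sum_le (n : ℕ) {d : ℕ → Ω → ℝ} (hdm : ∀ b < n, AEStronglyMeasurable (d b) μ)
    {bd : ℝ} (hdb : ∀ b < n, ∀ᵐ ω ∂μ, |d b ω| ≤ bd) :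
    Real.sqrt (∫ ω, (∑ b ∈ range n, d b ω) ^ 2 ∂μ) ≤ ∑ b ∈ range n, Real.sqrt (∫ ω, d b ω ^ 2 ∂μ) := by
  induction n with
  | zero => simp
  | succ n ih =>
    have ih' := ih (fun b hb => hdm b (by omega)) (fun b hb => hdb b (by omega))
    have hSm : AEStronglyMeasurable (fun ω => ∑ b ∈ range n, d b ω) μ :=
      Finset.aestronglyMeasurable_fun_sum (range n) fun b hb => hdm b (by have := mem_range.mp hb; omega)
    have hSb : ∀ᵐ ω ∂μ, |∑ b ∈ range n, d b ω| ≤ ∑ b ∈ range n, bd :=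
      ae_abs_sum_le (σ := fun _ => bd) fun b hb => hdb b (by omega)
    simp only [sum_range_succ]
    calc Real.sqrt (∫ ω, (∑ b ∈ range n, d b ω + d n ω) ^ 2 ∂μ)
        ≤ Real.sqrt (∫ ω, (∑ b ∈ range n, d b ω) ^ 2 ∂μ) + Real.sqrt (∫ ω, d n ω ^ 2 ∂μ) :=
          sqrt_integral_sq_add_le hSm hSb (hdm n (by omega)) (hdb n (by omega))
      _ ≤ ∑ b ∈ range n, Real.sqrt (∫ ω, d b ω ^ 2 ∂μ) + Real.sqrt (∫ ω, d n ω ^ 2 ∂μ) :=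
          add_le_add ih' le_rfl

/-- [folklore] **THE LADDER INEQUALITY**: for bounded `f` and bounded rungs `ψ 0, …, ψ n`,
`√∫(f − ψ 0)² ≤ Σ_{b<n} √∫(ψ (b+1) − ψ b)² + √∫(f − ψ n)²` (telescoping `f − ψ 0 = Σ_{b<n}(ψ (b+1) − ψ b) + (f − ψ n)`
and Minkowski; NO orthogonality between the rungs is used). -/
theorem sqrt_integral_sq_sub_le_ladder (n : ℕ) {f : Ω → ℝ} (hfm : AEStronglyMeasurable f μ) {R : ℝ}
    (hfR : ∀ᵐ ω ∂μ, |f ω| ≤ R) {ψ : ℕ → Ω → ℝ} (hψm : ∀ b ≤ n, AEStronglyMeasurable (ψ b) μ) {Cψ : ℝ}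
    (hψb : ∀ b ≤ n, ∀ᵐ ω ∂μ, |ψ b ω| ≤ Cψ) :
    Real.sqrt (∫ ω, (f ω - ψ 0 ω) ^ 2 ∂μ) ≤
      ∑ b ∈ range n, Real.sqrt (∫ ω, (ψ (b + 1) ω - ψ b ω) ^ 2 ∂μ) +
        Real.sqrt (∫ ω, (f ω - ψ n ω) ^ 2 ∂μ) := by
  have htel : ∀ ω, f ω - ψ 0 ω = (∑ b ∈ range n, (ψ (b + 1) ω - ψ b ω)) + (f ω - ψ n ω) := by
    intro ω
    rw [Finset.sum_range_sub (fun b => ψ b ω) n]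
    ring
  have heq : (fun ω => (f ω - ψ 0 ω) ^ 2) =
      fun ω => ((∑ b ∈ range n, (ψ (b + 1) ω - ψ b ω)) + (f ω - ψ n ω)) ^ 2 := by
    funext ω; rw [htel ω]
  have hdm : ∀ b < n, AEStronglyMeasurable (fun ω => ψ (b + 1) ω - ψ b ω) μ :=
    fun b hb => (hψm (b + 1) (by omega)).sub (hψm b (by omega))
  have hdb : ∀ b < n, ∀ᵐ ω ∂μ, |ψ (b + 1) ω - ψ b ω| ≤ Cψ + Cψ := by
    intro b hb
    filter_upwards [hψb (b + 1) (by omega), hψb b (by omega)] with ω h1 h2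
    exact (abs_sub _ _).trans (add_le_add h1 h2)
  have hSm : AEStronglyMeasurable (fun ω => ∑ b ∈ range n, (ψ (b + 1) ω - ψ b ω)) μ :=
    Finset.aestronglyMeasurable_fun_sum (range n) fun b hb => hdm b (mem_range.mp hb)
  have hSb : ∀ᵐ ω ∂μ, |∑ b ∈ range n, (ψ (b + 1) ω - ψ b ω)| ≤ ∑ b ∈ range n, (Cψ + Cψ) :=
    ae_abs_sum_le (σ := fun _ => Cψ + Cψ) hdb
  have hLm : AEStronglyMeasurable (fun ω => f ω - ψ n ω) μ := hfm.sub (hψm n le_rfl)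
  have hLb : ∀ᵐ ω ∂μ, |f ω - ψ n ω| ≤ R + Cψ := by
    filter_upwards [hfR, hψb n le_rfl] with ω h1 h2
    exact (abs_sub _ _).trans (add_le_add h1 h2)
  rw [heq]
  calc Real.sqrt (∫ ω, ((∑ b ∈ range n, (ψ (b + 1) ω - ψ b ω)) + (f ω - ψ n ω)) ^ 2 ∂μ)
      ≤ Real.sqrt (∫ ω, (∑ b ∈ range n, (ψ (b + 1) ω - ψ b ω)) ^ 2 ∂μ) +
          Real.sqrt (∫ ω, (f ω - ψ n ω) ^ 2 ∂μ) := sqrt_integral_sq_add_le hSm hSb hLm hLb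
    _ ≤ ∑ b ∈ range n, Real.sqrt (∫ ω, (ψ (b + 1) ω - ψ b ω) ^ 2 ∂μ) +
          Real.sqrt (∫ ω, (f ω - ψ n ω) ^ 2 ∂μ) :=
        add_le_add (sqrt_integral_sq_sum_le n hdm hdb) le_rfl

/-- [folklore] From `L²` to `L¹` on a finite measure space: `∫ |u| dμ ≤ √(μ(univ))·√(∫ u² dμ)`. -/
theorem integral_abs_le_sqrt_mul_sqrt {u : Ω → ℝ} (hum : AEStronglyMeasurable u μ) {bu : ℝ}
    (hub : ∀ᵐ ω ∂μ, |u ω| ≤ bu) :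
    ∫ ω, |u ω| ∂μ ≤ Real.sqrt (μ.real Set.univ) * Real.sqrt (∫ ω, u ω ^ 2 ∂μ) := by
  have hu2 : Integrable (fun ω => |u ω| ^ 2) μ := by
    refine (integrable_sq_of_ae_abs_le hum hub).congr (ae_of_all μ fun ω => ?_)
    simp only [sq_abs]
  have h12 : Integrable (fun _ : Ω => (1 : ℝ) ^ 2) μ := integrable_const _
  have hu1 : Integrable (fun ω => |u ω| * 1) μ := by
    refine (integrable_of_ae_abs_le hum hub).abs.congr (ae_of_all μ fun ω => ?_)
    simp
  have h := abs_integral_mul_le_sqrt_mul_sqrt_of_integrable hu2 h12 hu1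
  have hl : ∫ ω, |u ω| * 1 ∂μ = ∫ ω, |u ω| ∂μ := by simp
  have h1 : ∫ _ : Ω, (1 : ℝ) ^ 2 ∂μ = μ.real Set.univ := by simp
  have h2 : ∫ ω, |u ω| ^ 2 ∂μ = ∫ ω, u ω ^ 2 ∂μ := integral_congr_ae (ae_of_all μ fun ω => by simp only [sq_abs])
  rw [hl, h1, h2, abs_of_nonneg (integral_nonneg fun ω => abs_nonneg _)] at h
  rw [mul_comm]
  exact h

omit [IsFiniteMeasure μ] in
/-- [folklore] **exp-Lipschitz for scaled bounded exponents**: for `|a|, |b| ≤ R` and real `t`,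
`|e^{ta} − e^{tb}| ≤ e^{|t|R}·|t|·|a − b|` (from `1 + x ≤ eˣ`; the un-scaled inequality
`|eᵘ − eᵛ| ≤ e^{M}|u − v|` on `[−M, M]` is the `key` step of the proof). -/
theorem abs_exp_mul_sub_exp_mul_le {a b R : ℝ} (ha : |a| ≤ R) (hb : |b| ≤ R) (t : ℝ) :
    |Real.exp (t * a) - Real.exp (t * b)| ≤ Real.exp (|t| * R) * (|t| * |a - b|) := by
  have key : ∀ u v M : ℝ, |u| ≤ M → |v| ≤ M → |Real.exp u - Real.exp v| ≤ Real.exp M * |u - v| := by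
    intro u v M hu hv
    have huM : Real.exp u ≤ Real.exp M := Real.exp_le_exp.mpr (abs_le.mp hu).2
    have hvM : Real.exp v ≤ Real.exp M := Real.exp_le_exp.mpr (abs_le.mp hv).2
    have h1 : Real.exp u - Real.exp v ≤ Real.exp u * (u - v) := by
      have h := Real.add_one_le_exp (v - u)
      have heq : Real.exp v = Real.exp u * Real.exp (v - u) := by rw [← Real.exp_add]; ring_nf
      rw [heq]
      nlinarith [Real.exp_pos u]
    have h2 : Real.exp v - Real.exp u ≤ Real.exp v * (v - u) := by
      have h := Real.add_one_le_exp (u - v)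
      have heq : Real.exp u = Real.exp v * Real.exp (u - v) := by rw [← Real.exp_add]; ring_nf
      rw [heq]
      nlinarith [Real.exp_pos v]
    rcases le_total v u with h | h
    · rw [abs_of_nonneg (sub_nonneg.mpr (Real.exp_le_exp.mpr h)), abs_of_nonneg (sub_nonneg.mpr h)]
      exact h1.trans (mul_le_mul_of_nonneg_right huM (sub_nonneg.mpr h))
    · rw [abs_of_nonpos (sub_nonpos.mpr (Real.exp_le_exp.mpr h)), abs_of_nonpos (sub_nonpos.mpr h), neg_sub,
        neg_sub]
      exact h2.trans (mul_le_mul_of_nonneg_right hvM (sub_nonneg.mpr h))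
  have hta : |t * a| ≤ |t| * R := by rw [abs_mul]; exact mul_le_mul_of_nonneg_left ha (abs_nonneg t)
  have htb : |t * b| ≤ |t| * R := by rw [abs_mul]; exact mul_le_mul_of_nonneg_left hb (abs_nonneg t)
  have h := key (t * a) (t * b) (|t| * R) hta htb
  rwa [← mul_sub, abs_mul] at h

/-- [folklore] **The exponential comparison of two bounded exponents in `L¹`, priced by their `L²` distance**: for
`|h|, |Z| ≤ R`, a bounded weight `|g| ≤ Cg` and any real `t`,
`|∫ g·(e^{t h} − e^{t Z}) dμ| ≤ |t|·e^{|t|R}·Cg·√(μ(univ))·√(∫ (h − Z)² dμ)`. -/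
theorem abs_integral_mul_exp_sub_exp_le {h Z g : Ω → ℝ} (hhm : AEStronglyMeasurable h μ)
    (hZm : AEStronglyMeasurable Z μ) {R : ℝ} (hhR : ∀ ω, |h ω| ≤ R) (hZR : ∀ ω, |Z ω| ≤ R) {Cg : ℝ}
    (hCg : 0 ≤ Cg) (hgC : ∀ ω, |g ω| ≤ Cg) (t : ℝ) :
    |∫ ω, g ω * (Real.exp (t * h ω) - Real.exp (t * Z ω)) ∂μ| ≤
      |t| * Real.exp (|t| * R) * Cg * (Real.sqrt (μ.real Set.univ) * Real.sqrt (∫ ω, (h ω - Z ω) ^ 2 ∂μ)) := by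
  have hpt : ∀ ω, |g ω * (Real.exp (t * h ω) - Real.exp (t * Z ω))| ≤
      |t| * Real.exp (|t| * R) * Cg * |h ω - Z ω| := by
    intro ω
    have he := abs_exp_mul_sub_exp_mul_le (hhR ω) (hZR ω) t
    rw [abs_mul]
    calc |g ω| * |Real.exp (t * h ω) - Real.exp (t * Z ω)|
        ≤ Cg * (Real.exp (|t| * R) * (|t| * |h ω - Z ω|)) := mul_le_mul (hgC ω) he (abs_nonneg _) hCg
      _ = |t| * Real.exp (|t| * R) * Cg * |h ω - Z ω| := by ring
  have hdm : AEStronglyMeasurable (fun ω => h ω - Z ω) μ := hhm.sub hZm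
  have hdb : ∀ᵐ ω ∂μ, |h ω - Z ω| ≤ R + R :=
    ae_of_all μ fun ω => (abs_sub _ _).trans (add_le_add (hhR ω) (hZR ω))
  have hdi : Integrable (fun ω => |h ω - Z ω|) μ := (integrable_of_ae_abs_le hdm hdb).abs
  have hL1 := integral_abs_le_sqrt_mul_sqrt hdm hdb
  have hK : 0 ≤ |t| * Real.exp (|t| * R) * Cg :=
    mul_nonneg (mul_nonneg (abs_nonneg _) (Real.exp_pos _).le) hCg
  calc |∫ ω, g ω * (Real.exp (t * h ω) - Real.exp (t * Z ω)) ∂μ|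
      ≤ ∫ ω, |g ω * (Real.exp (t * h ω) - Real.exp (t * Z ω))| ∂μ := abs_integral_le_integral_abs
    _ ≤ ∫ ω, |t| * Real.exp (|t| * R) * Cg * |h ω - Z ω| ∂μ :=
        integral_mono_of_nonneg (ae_of_all μ fun ω => abs_nonneg _) (hdi.const_mul _) (ae_of_all μ hpt)
    _ = |t| * Real.exp (|t| * R) * Cg * ∫ ω, |h ω - Z ω| ∂μ := integral_const_mul _ _
    _ ≤ |t| * Real.exp (|t| * R) * Cg *
          (Real.sqrt (μ.real Set.univ) * Real.sqrt (∫ ω, (h ω - Z ω) ^ 2 ∂μ)) :=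
        mul_le_mul_of_nonneg_left hL1 hK

end LTwo

/-! ## §1b  Exponential comparison of two bounded exponents, priced by their `L²` distance -/

section ExpCompare

variable {Ω : Type*} {mΩ : MeasurableSpace Ω} {μ : Measure Ω} [IsFiniteMeasure μ]

omit [IsFiniteMeasure μ] in
/-- [folklore] `|a·e^{t x}| ≤ Cg·e^{|t| R}` for `|a| ≤ Cg`, `|x| ≤ R`. -/
theorem abs_mul_exp_le {a x Cg R : ℝ} (ha : |a| ≤ Cg) (hx : |x| ≤ R) (t : ℝ) :
    |a * Real.exp (t * x)| ≤ Cg * Real.exp (|t| * R) := by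
  rw [abs_mul, abs_of_pos (Real.exp_pos _)]
  refine mul_le_mul ha ?_ (Real.exp_pos _).le ((abs_nonneg _).trans ha)
  refine Real.exp_le_exp.mpr ((le_abs_self _).trans ?_)
  rw [abs_mul]
  exact mul_le_mul_of_nonneg_left hx (abs_nonneg _)

omit [IsFiniteMeasure μ] in
/-- [folklore] A bounded weight times the exponential of a bounded measurable exponent is integrable on a finite
measure space. -/
theorem integrable_mul_exp [IsFiniteMeasure μ] {h g : Ω → ℝ} (hhm : StronglyMeasurable h)
    (hgm : StronglyMeasurable g) {R : ℝ} (hhR : ∀ ω, |h ω| ≤ R) {Cg : ℝ} (hgC : ∀ ω, |g ω| ≤ Cg) (t : ℝ) :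
    Integrable (fun ω => g ω * Real.exp (t * h ω)) μ :=
  integrable_of_abs_le_const
    (hgm.measurable.mul (Real.measurable_exp.comp (hhm.measurable.const_mul t))).stronglyMeasurable
    fun ω => abs_mul_exp_le (hgC ω) (hhR ω) t

/-- [folklore] **ONE-SIDED EXPONENTIAL COMPARISON priced by the `L²` distance of the exponents**: for bounded
measurable `h`, `Z` (`|h|, |Z| ≤ R`), a bounded measurable weight `|g| ≤ Cg` and real `t`,
`∫ g·e^{t h} dμ ≤ ∫ g·e^{t Z} dμ + |t|·e^{|t|R}·Cg·√(μ(univ))·√(∫ (h − Z)² dμ)`. -/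
theorem integral_mul_exp_le_add_of_sq {h Z g : Ω → ℝ} (hhm : StronglyMeasurable h)
    (hZm : StronglyMeasurable Z) (hgm : StronglyMeasurable g) {R : ℝ} (hhR : ∀ ω, |h ω| ≤ R)
    (hZR : ∀ ω, |Z ω| ≤ R) {Cg : ℝ} (hCg : 0 ≤ Cg) (hgC : ∀ ω, |g ω| ≤ Cg) (t : ℝ) :
    ∫ ω, g ω * Real.exp (t * h ω) ∂μ ≤ ∫ ω, g ω * Real.exp (t * Z ω) ∂μ +
      |t| * Real.exp (|t| * R) * Cg *
        (Real.sqrt (μ.real Set.univ) * Real.sqrt (∫ ω, (h ω - Z ω) ^ 2 ∂μ)) := by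
  have hI1 : Integrable (fun ω => g ω * Real.exp (t * h ω)) μ := integrable_mul_exp hhm hgm hhR hgC t
  have hI2 : Integrable (fun ω => g ω * Real.exp (t * Z ω)) μ := integrable_mul_exp hZm hgm hZR hgC t
  have hM := abs_integral_mul_exp_sub_exp_le (μ := μ) hhm.aestronglyMeasurable hZm.aestronglyMeasurable hhR
    hZR hCg hgC t
  have hsub : ∫ ω, g ω * (Real.exp (t * h ω) - Real.exp (t * Z ω)) ∂μ =
      ∫ ω, g ω * Real.exp (t * h ω) ∂μ - ∫ ω, g ω * Real.exp (t * Z ω) ∂μ := by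
    rw [← integral_sub hI1 hI2]
    exact integral_congr_ae (ae_of_all μ fun ω => by ring)
  have h1 := (le_abs_self _).trans hM
  linarith

end ExpCompare

/-! ## §2  The variance identity on the chain: accumulated one-step conditional variances = the conditional
variance of the observable given the endpoint -/

section ChainVariance

variable {X : ℕ → Type*} [∀ n, MeasurableSpace (X n)]
variable {κ : (b : ℕ) → Kernel (Π i : Iic b, X i) (X (b + 1))} [∀ b, IsMarkovKernel (κ b)]

/-- [folklore] **The endpoint marginal of the path law is the endpoint law**: `(trajMeasure ν κ).map (· 0) = ν`. -/
theorem map_eval_zero_trajMeasure (ν : Measure (X 0)) :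
    (Kernel.trajMeasure ν κ).map (fun x => x 0) = ν := by
  have h1 : (fun x : Π k, X k => x 0) = endpointValue ∘ frestrictLe (π := X) 0 := rfl
  rw [h1, ← Measure.map_map measurable_endpointValue (measurable_frestrictLe 0),
    map_frestrictLe_zero_trajMeasure, Measure.map_map measurable_endpointValue measurable_endpointHistory]
  have h2 : endpointValue ∘ endpointHistory (X := X) = id := funext fun z => rfl
  rw [h2, Measure.map_id]

/-- [folklore] **Functions of the endpoint value integrate against `ν`**: `∫ G (x 0) dμ = ∫ G dν`. -/
theorem integral_comp_eval_zero (ν : Measure (X 0)) {G : X 0 → ℝ} (hG : AEStronglyMeasurable G ν) :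
    ∫ x, G (x 0) ∂(Kernel.trajMeasure ν κ) = ∫ z, G z ∂ν := by
  have hG' : AEStronglyMeasurable G ((Kernel.trajMeasure ν κ).map (fun x => x 0)) := by
    rwa [map_eval_zero_trajMeasure]
  rw [← integral_map (measurable_pi_apply 0).aemeasurable hG', map_eval_zero_trajMeasure]

/-- [folklore] The path law and the endpoint law have the same total mass. -/
theorem measureReal_univ_trajMeasure (ν : Measure (X 0)) :
    (Kernel.trajMeasure ν κ).real Set.univ = ν.real Set.univ := by
  have h : ((Kernel.trajMeasure ν κ).map (fun x => x 0)) Set.univ = ν Set.univ := by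
    rw [map_eval_zero_trajMeasure]
  rw [Measure.map_apply (measurable_pi_apply 0) MeasurableSet.univ, Set.preimage_univ] at h
  rw [measureReal_def, measureReal_def, h]

/-- [folklore] The tower mean of an observable bounded by `R` is bounded by `R`. -/
theorem abs_towerMean_le {φ : (Π n, X n) → ℝ} (hφm : StronglyMeasurable φ) {R : ℝ} (hφR : ∀ x, |φ x| ≤ R)
    (z : X 0) : |towerMean κ φ z| ≤ R :=
  abs_fiberMean_le 0 hφm hφR _

/-- [folklore] **THE VARIANCE IDENTITY ON THE CHAIN.**  For a bounded `piLE n`-measurable path observable `φ` under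
the realised path law `μ = trajMeasure ν κ` (finite endpoint law `ν`):
`Σ_{b<n} ∫ oneStepVar κ b φ (x≤b) dμ = ∫ (φ − towerMean κ φ (x 0))² dμ` —
the accumulated one-step conditional variances of the conditional means of `φ` integrate EXACTLY to the conditional
variance of `φ` given the endpoint.  (Orthogonality of the Doob increments along the frame filtration,
`T4MeanChannel.integral_sq_condExp_sub_eq_sum`; each `∫ incr_i² dμ = ∫ μ[incr_i² ∣ F (i+1)] dμ = ∫ oneStepVar dμ` by
`T4CouplingChain.condExp_incr_sq_frame_ae_eq`; `μ[φ ∣ F 0] = φ`, `μ[φ ∣ F n] = towerMean κ φ (x 0)` a.e.) -/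
theorem sum_integral_oneStepVar_eq (ν : Measure (X 0)) [IsFiniteMeasure ν] (n : ℕ) {φ : (Π k, X k) → ℝ}
    (hφn : StronglyMeasurable[piLE (X := X) n] φ) {R : ℝ} (hφR : ∀ x, |φ x| ≤ R) :
    ∑ b ∈ range n, ∫ x, oneStepVar κ b φ (frestrictLe b x) ∂(Kernel.trajMeasure ν κ) =
      ∫ x, (φ x - towerMean κ φ (x 0)) ^ 2 ∂(Kernel.trajMeasure ν κ) := by
  set μ := Kernel.trajMeasure ν κ with hμ
  have hφm : StronglyMeasurable φ := hφn.mono ((piLE (X := X)).le n)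
  have hφi : Integrable φ μ := integrable_of_abs_le_const hφm hφR
  have hF := antitone_frameFiltration (X := X) n
  have hFle := frameFiltration_le (X := X) n
  haveI : SigmaFinite (μ.trim (hFle 0)) := inferInstance
  have hpy := integral_sq_condExp_sub_eq_sum (μ := μ) hF hFle hφR 0 n
  simp only [Nat.zero_add] at hpy
  have h0 : μ[φ | frameFiltration X n 0] = φ :=
    condExp_of_stronglyMeasurable (hFle 0) (stronglyMeasurable_frame_zero hφn) hφi
  rw [h0] at hpy
  have hn : μ[φ | frameFiltration X n n] =ᵐ[μ] fun x => towerMean κ φ (x 0) := by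
    rw [frameFiltration_self]
    exact condExp_endpoint_ae_eq_towerMean ν hφi
  have hlhs : ∫ x, (φ x - μ[φ | frameFiltration X n n] x) ^ 2 ∂μ =
      ∫ x, (φ x - towerMean κ φ (x 0)) ^ 2 ∂μ := by
    refine integral_congr_ae ?_
    filter_upwards [hn] with x hx
    rw [hx]
  rw [← hlhs, hpy]
  have hterm : ∀ i ∈ range n, ∫ x, incr μ (frameFiltration X n) φ i x ^ 2 ∂μ =
      ∫ x, oneStepVar κ (n - (i + 1)) φ (frestrictLe (n - (i + 1)) x) ∂μ := by
    intro i hi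
    haveI : SigmaFinite (μ.trim (hFle (i + 1))) := inferInstance
    rw [← integral_condExp (hFle (i + 1))]
    exact integral_congr_ae (condExp_incr_sq_frame_ae_eq ν n hφm hφR (mem_range.mp hi))
  rw [Finset.sum_congr rfl hterm]
  exact (sum_range_reflect_succ (fun b => ∫ x, oneStepVar κ b φ (frestrictLe b x) ∂μ) n).symm

/-- [folklore] **PYTHAGORAS AT THE ENDPOINT.**  For bounded measurable `φ` and ANY bounded measurable endpoint function
`Z : X 0 → ℝ`: `∫ (φ − Z (x 0))² dμ = ∫ (φ − towerMean κ φ (x 0))² dμ + ∫ (towerMean κ φ − Z)² dν`. -/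
theorem integral_sq_sub_endpoint_eq_add (ν : Measure (X 0)) [IsFiniteMeasure ν] {φ : (Π k, X k) → ℝ}
    (hφm : StronglyMeasurable φ) {R : ℝ} (hφR : ∀ x, |φ x| ≤ R) {Z : X 0 → ℝ} (hZm : StronglyMeasurable Z)
    {CZ : ℝ} (hZb : ∀ z, |Z z| ≤ CZ) :
    ∫ x, (φ x - Z (x 0)) ^ 2 ∂(Kernel.trajMeasure ν κ) =
      ∫ x, (φ x - towerMean κ φ (x 0)) ^ 2 ∂(Kernel.trajMeasure ν κ) +
        ∫ z, (towerMean κ φ z - Z z) ^ 2 ∂ν := by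
  set μ := Kernel.trajMeasure ν κ with hμ
  have hφi : Integrable φ μ := integrable_of_abs_le_const hφm hφR
  have hZ' : StronglyMeasurable[piLE (X := X) 0] (fun x : Π k, X k => Z (x 0)) :=
    hZm.comp_measurable (measurable_eval_piLE le_rfl)
  have h := integral_sq_sub_eq_add_of_condExp (μ := μ) ((piLE (X := X)).le 0) hφm hφR hZ' (fun x => hZb (x 0))
  have hce := condExp_endpoint_ae_eq_towerMean (κ := κ) ν hφi
  have h1 : ∫ x, (φ x - μ[φ | piLE (X := X) 0] x) ^ 2 ∂μ = ∫ x, (φ x - towerMean κ φ (x 0)) ^ 2 ∂μ :=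
    integral_congr_ae (by filter_upwards [hce] with x hx; rw [hx])
  have h2 : ∫ x, (μ[φ | piLE (X := X) 0] x - Z (x 0)) ^ 2 ∂μ = ∫ z, (towerMean κ φ z - Z z) ^ 2 ∂ν := by
    have h2a : ∫ x, (μ[φ | piLE (X := X) 0] x - Z (x 0)) ^ 2 ∂μ =
        ∫ x, (towerMean κ φ (x 0) - Z (x 0)) ^ 2 ∂μ :=
      integral_congr_ae (by filter_upwards [hce] with x hx; rw [hx])
    rw [h2a]
    exact integral_comp_eval_zero ν (G := fun z => (towerMean κ φ z - Z z) ^ 2)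
      (((stronglyMeasurable_towerMean (κ := κ) hφm).measurable.sub hZm.measurable).pow_const 2
        ).aestronglyMeasurable
  rw [h, h1, h2]

/-- [folklore] **THE ENDPOINT DEFECT DOMINATES THE CONDITIONAL VARIANCE**: `∫ (φ − towerMean κ φ (x 0))² dμ ≤
∫ (φ − Z (x 0))² dμ` for every bounded measurable `Z : X 0 → ℝ` (the tower mean is the `L²`-optimal endpoint
predictor).  In the dictionary: the conditional variance of the unit-scale observable given the unit-lattice field
is at most its mean-square distance to the loop OF the unit-lattice field (or to any other function of it). -/
theorem integral_sq_sub_towerMean_le (ν : Measure (X 0)) [IsFiniteMeasure ν] {φ : (Π k, X k) → ℝ}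
    (hφm : StronglyMeasurable φ) {R : ℝ} (hφR : ∀ x, |φ x| ≤ R) {Z : X 0 → ℝ} (hZm : StronglyMeasurable Z)
    {CZ : ℝ} (hZb : ∀ z, |Z z| ≤ CZ) :
    ∫ x, (φ x - towerMean κ φ (x 0)) ^ 2 ∂(Kernel.trajMeasure ν κ) ≤
      ∫ x, (φ x - Z (x 0)) ^ 2 ∂(Kernel.trajMeasure ν κ) := by
  rw [integral_sq_sub_endpoint_eq_add ν hφm hφR hZm hZb]
  exact le_add_of_nonneg_right (integral_nonneg fun _ => sq_nonneg _)

/-- [folklore] **THE ENDPOINT DEFECT DOMINATES THE MEAN CHANNEL (integrated form)**: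
`∫ (towerMean κ φ − Z)² dν ≤ ∫ (φ − Z (x 0))² dμ`.  In the dictionary: the mean-square deviation of the dressed
conditional mean `h_K` from the naive value `W_C` is at most the same one number. -/
theorem integral_sq_towerMean_sub_le (ν : Measure (X 0)) [IsFiniteMeasure ν] {φ : (Π k, X k) → ℝ}
    (hφm : StronglyMeasurable φ) {R : ℝ} (hφR : ∀ x, |φ x| ≤ R) {Z : X 0 → ℝ} (hZm : StronglyMeasurable Z)
    {CZ : ℝ} (hZb : ∀ z, |Z z| ≤ CZ) :
    ∫ z, (towerMean κ φ z - Z z) ^ 2 ∂ν ≤ ∫ x, (φ x - Z (x 0)) ^ 2 ∂(Kernel.trajMeasure ν κ) := by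
  rw [integral_sq_sub_endpoint_eq_add ν hφm hφR hZm hZb]
  exact le_add_of_nonneg_left (integral_nonneg fun _ => sq_nonneg _)

/-! ## §3  End-to-end from ONE number -/

/-- [folklore] **END-TO-END FROM THE CONDITIONAL VARIANCE (realised chain).**  `|φ| ≤ R` `piLE n`-measurable,
`|t|·2R ≤ 1`, `B > 0`, `0 ≤ g₀ ≤ Cg` measurable, and the ONE NUMBER `∫ (φ − towerMean κ φ (x 0))² dμ ≤ 𝒱`:
`∫ g₀(x 0)·e^{tφ} dμ ≤ e^{t²B}·∫ g₀·e^{t·towerMean κ φ} dν + e^{|t|R}·Cg·B⁻¹·𝒱`.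
(`T4CouplingChain.integral_mul_exp_le_condVar` + Markov on the accumulated one-step variances + the variance identity
`sum_integral_oneStepVar_eq`.)  Choosing `B = 𝒱^{1/2}` makes both corrections `O(𝒱^{1/2})` for `|t| ≤ 1/(2R)`. -/
theorem integral_mul_exp_le_of_condVariance (ν : Measure (X 0)) [IsFiniteMeasure ν] (n : ℕ)
    {φ : (Π k, X k) → ℝ} (hφn : StronglyMeasurable[piLE (X := X) n] φ) {R : ℝ} (hφR : ∀ x, |φ x| ≤ R)
    {t : ℝ} (ht : |t| * (2 * R) ≤ 1) {B : ℝ} (hB : 0 < B) {g₀ : X 0 → ℝ} (hg : StronglyMeasurable g₀)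
    (hg0 : ∀ z, 0 ≤ g₀ z) {Cg : ℝ} (hCg : 0 ≤ Cg) (hgC : ∀ z, g₀ z ≤ Cg) {𝒱 : ℝ}
    (hV : ∫ x, (φ x - towerMean κ φ (x 0)) ^ 2 ∂(Kernel.trajMeasure ν κ) ≤ 𝒱) :
    ∫ x, g₀ (x 0) * Real.exp (t * φ x) ∂(Kernel.trajMeasure ν κ) ≤
      Real.exp (t ^ 2 * B) * ∫ z, g₀ z * Real.exp (t * towerMean κ φ z) ∂ν +
        Real.exp (|t| * R) * (Cg * (B⁻¹ * 𝒱)) := by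
  have hφm : StronglyMeasurable φ := hφn.mono ((piLE (X := X)).le n)
  have h := integral_mul_exp_le_condVar (κ := κ) ν n hφn hφR ht B hg hg0 hgC
  set μ := Kernel.trajMeasure ν κ with hμ
  set S : (Π k, X k) → ℝ := fun x => ∑ b ∈ range n, oneStepVar κ b φ (frestrictLe b x) with hS
  have hS0 : ∀ x, 0 ≤ S x := fun x => Finset.sum_nonneg fun b _ => oneStepVar_nonneg b φ _
  have hterm : ∀ b ∈ range n, Integrable (fun x : Π k, X k => oneStepVar κ b φ (frestrictLe b x)) μ :=
    fun b _ => integrable_of_abs_le_const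
      ((stronglyMeasurable_oneStepVar (κ := κ) b hφm).comp_measurable (measurable_frestrictLe b))
      (fun x => abs_oneStepVar_le b hφm hφR _)
  have hSi : Integrable S μ := integrable_finsetSum (range n) hterm
  have hint : ∫ x, S x ∂μ = ∫ x, (φ x - towerMean κ φ (x 0)) ^ 2 ∂μ := by
    rw [hS, integral_finsetSum (range n) hterm]
    exact sum_integral_oneStepVar_eq ν n hφn hφR
  have hmk : B * μ.real {x | B ≤ S x} ≤ ∫ x, S x ∂μ :=
    mul_meas_ge_le_integral_of_nonneg (ae_of_all μ hS0) hSi B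
  have hsub : {x | B < S x} ⊆ {x | B ≤ S x} := fun x (hx : B < S x) => show B ≤ S x from le_of_lt hx
  have htail : μ.real {x | B < S x} ≤ B⁻¹ * 𝒱 :=
    calc μ.real {x | B < S x} ≤ μ.real {x | B ≤ S x} := measureReal_mono hsub (measure_ne_top μ _)
      _ ≤ B⁻¹ * ∫ x, S x ∂μ := by rw [le_inv_mul_iff₀ hB]; exact hmk
      _ ≤ B⁻¹ * 𝒱 := mul_le_mul_of_nonneg_left (hint ▸ hV) (inv_pos.mpr hB).le
  exact h.trans (add_le_add le_rfl
    (mul_le_mul_of_nonneg_left (mul_le_mul_of_nonneg_left htail hCg) (Real.exp_pos _).le))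

/-- [folklore] **END-TO-END FROM THE ENDPOINT DEFECT (realised chain)** — the form MI-V of the record: the same
conclusion from `∫ (φ − Z (x 0))² dμ ≤ 𝒱` for ANY bounded measurable endpoint function `Z` (in the dictionary
`Z = W_C`, the loop of the unit-lattice field: `𝒱 ≥ E_{μ_K}(W_C(avg^K V_0) − W_C(V_K))²`). -/
theorem integral_mul_exp_le_of_sqDefect (ν : Measure (X 0)) [IsFiniteMeasure ν] (n : ℕ)
    {φ : (Π k, X k) → ℝ} (hφn : StronglyMeasurable[piLE (X := X) n] φ) {R : ℝ} (hφR : ∀ x, |φ x| ≤ R)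
    {t : ℝ} (ht : |t| * (2 * R) ≤ 1) {B : ℝ} (hB : 0 < B) {g₀ : X 0 → ℝ} (hg : StronglyMeasurable g₀)
    (hg0 : ∀ z, 0 ≤ g₀ z) {Cg : ℝ} (hCg : 0 ≤ Cg) (hgC : ∀ z, g₀ z ≤ Cg)
    {Z : X 0 → ℝ} (hZm : StronglyMeasurable Z) {CZ : ℝ} (hZb : ∀ z, |Z z| ≤ CZ) {𝒱 : ℝ}
    (hV : ∫ x, (φ x - Z (x 0)) ^ 2 ∂(Kernel.trajMeasure ν κ) ≤ 𝒱) :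
    ∫ x, g₀ (x 0) * Real.exp (t * φ x) ∂(Kernel.trajMeasure ν κ) ≤
      Real.exp (t ^ 2 * B) * ∫ z, g₀ z * Real.exp (t * towerMean κ φ z) ∂ν +
        Real.exp (|t| * R) * (Cg * (B⁻¹ * 𝒱)) :=
  integral_mul_exp_le_of_condVariance ν n hφn hφR ht hB hg hg0 hCg hgC
    ((integral_sq_sub_towerMean_le ν (hφn.mono ((piLE (X := X)).le n)) hφR hZm hZb).trans hV)

/-- [folklore] **THE INTEGRATED MEAN CHANNEL FROM THE SAME NUMBER.**  For bounded measurable `φ` (`|φ| ≤ R`), a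
measurable endpoint function `|Z| ≤ R`, a bounded weight `|g₀| ≤ Cg` and real `t`:
`|∫ g₀·(e^{t·towerMean κ φ} − e^{tZ}) dν| ≤ |t|·e^{|t|R}·Cg·√(ν(univ))·√(∫ (φ − Z (x 0))² dμ)`. -/
theorem abs_integral_mul_exp_towerMean_sub_exp_le (ν : Measure (X 0)) [IsFiniteMeasure ν]
    {φ : (Π k, X k) → ℝ} (hφm : StronglyMeasurable φ) {R : ℝ} (hφR : ∀ x, |φ x| ≤ R)
    {Z : X 0 → ℝ} (hZm : StronglyMeasurable Z) (hZR : ∀ z, |Z z| ≤ R) {g₀ : X 0 → ℝ} {Cg : ℝ}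
    (hCg : 0 ≤ Cg) (hgC : ∀ z, |g₀ z| ≤ Cg) (t : ℝ) :
    |∫ z, g₀ z * (Real.exp (t * towerMean κ φ z) - Real.exp (t * Z z)) ∂ν| ≤
      |t| * Real.exp (|t| * R) * Cg * (Real.sqrt (ν.real Set.univ) *
        Real.sqrt (∫ x, (φ x - Z (x 0)) ^ 2 ∂(Kernel.trajMeasure ν κ))) := by
  have h1 := abs_integral_mul_exp_sub_exp_le (μ := ν)
    (stronglyMeasurable_towerMean (κ := κ) hφm).aestronglyMeasurable hZm.aestronglyMeasurable
    (abs_towerMean_le hφm hφR) hZR hCg hgC t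
  refine h1.trans (mul_le_mul_of_nonneg_left (mul_le_mul_of_nonneg_left
    (Real.sqrt_le_sqrt (integral_sq_towerMean_sub_le ν hφm hφR hZm hZR)) (Real.sqrt_nonneg _)) ?_)
  exact mul_nonneg (mul_nonneg (abs_nonneg _) (Real.exp_pos _).le) hCg

/-- [folklore] **JENSEN, CHAIN FORM**: `∫ g₀·e^{t·towerMean κ φ} dν ≤ ∫ g₀(x 0)·e^{tφ} dμ` for `0 ≤ g₀ ≤ Cg`
measurable and `φ` bounded `piLE n`-measurable (conditional Jensen at the endpoint,
`T4PathwiseCoupling.integral_mul_exp_mean_le`). -/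
theorem integral_mul_exp_towerMean_le (ν : Measure (X 0)) [IsFiniteMeasure ν] (n : ℕ)
    {φ : (Π k, X k) → ℝ} (hφn : StronglyMeasurable[piLE (X := X) n] φ) {R : ℝ} (hφR : ∀ x, |φ x| ≤ R)
    {g₀ : X 0 → ℝ} (hg : StronglyMeasurable g₀) (hg0 : ∀ z, 0 ≤ g₀ z) {Cg : ℝ} (hgC : ∀ z, g₀ z ≤ Cg) (t : ℝ) :
    ∫ z, g₀ z * Real.exp (t * towerMean κ φ z) ∂ν ≤
      ∫ x, g₀ (x 0) * Real.exp (t * φ x) ∂(Kernel.trajMeasure ν κ) := by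
  have hφm : StronglyMeasurable φ := hφn.mono ((piLE (X := X)).le n)
  have h := integral_mul_exp_mean_le (μ := Kernel.trajMeasure ν κ) (antitone_frameFiltration n)
    (frameFiltration_le n) (stronglyMeasurable_frame_zero hφn) hφR n t (stronglyMeasurable_endpoint hg n n)
    (fun x => hg0 (x 0)) (fun x => hgC (x 0))
  rwa [integral_mul_exp_condExp_endpoint_eq ν n hφm hφR hg t] at h

/-- [folklore] **NAIVE REWEIGHTING, LOWER SIDE.**  With `∫ (φ − Z (x 0))² dμ ≤ 𝒱` (`|Z| ≤ R`):
`∫ g₀·e^{tZ} dν ≤ ∫ g₀(x 0)·e^{tφ} dμ + |t|·e^{|t|R}·Cg·√(ν(univ))·√𝒱` — the naively reweighted undressed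
endpoint law `e^{tZ}·ν` underestimates the dressed endpoint integrals by at most `O(|t|·𝒱^{1/2})`. -/
theorem integral_mul_exp_naive_le_add (ν : Measure (X 0)) [IsFiniteMeasure ν] (n : ℕ)
    {φ : (Π k, X k) → ℝ} (hφn : StronglyMeasurable[piLE (X := X) n] φ) {R : ℝ} (hφR : ∀ x, |φ x| ≤ R)
    {Z : X 0 → ℝ} (hZm : StronglyMeasurable Z) (hZR : ∀ z, |Z z| ≤ R) {g₀ : X 0 → ℝ}
    (hg : StronglyMeasurable g₀) (hg0 : ∀ z, 0 ≤ g₀ z) {Cg : ℝ} (hCg : 0 ≤ Cg) (hgC : ∀ z, g₀ z ≤ Cg) (t : ℝ)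
    {𝒱 : ℝ} (hV : ∫ x, (φ x - Z (x 0)) ^ 2 ∂(Kernel.trajMeasure ν κ) ≤ 𝒱) :
    ∫ z, g₀ z * Real.exp (t * Z z) ∂ν ≤
      ∫ x, g₀ (x 0) * Real.exp (t * φ x) ∂(Kernel.trajMeasure ν κ) +
        |t| * Real.exp (|t| * R) * Cg * (Real.sqrt (ν.real Set.univ) * Real.sqrt 𝒱) := by
  have hφm : StronglyMeasurable φ := hφn.mono ((piLE (X := X)).le n)
  have hgabs : ∀ z, |g₀ z| ≤ Cg := fun z => abs_le.mpr ⟨by linarith [hg0 z, hgC z], hgC z⟩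
  have hJ := integral_mul_exp_towerMean_le (κ := κ) ν n hφn hφR hg hg0 hgC t
  have hcmp := integral_mul_exp_le_add_of_sq (μ := ν) hZm (stronglyMeasurable_towerMean (κ := κ) hφm) hg hZR
    (abs_towerMean_le hφm hφR) hCg hgabs t
  have hsq : ∫ z, (Z z - towerMean κ φ z) ^ 2 ∂ν ≤ 𝒱 := by
    have he : ∫ z, (Z z - towerMean κ φ z) ^ 2 ∂ν = ∫ z, (towerMean κ φ z - Z z) ^ 2 ∂ν :=
      integral_congr_ae (ae_of_all ν fun z => by ring)
    rw [he]
    exact (integral_sq_towerMean_sub_le ν hφm hφR hZm hZR).trans hV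
  have hK : 0 ≤ |t| * Real.exp (|t| * R) * Cg := mul_nonneg (mul_nonneg (abs_nonneg _) (Real.exp_pos _).le) hCg
  have hroot : Real.sqrt (ν.real Set.univ) * Real.sqrt (∫ z, (Z z - towerMean κ φ z) ^ 2 ∂ν) ≤
      Real.sqrt (ν.real Set.univ) * Real.sqrt 𝒱 :=
    mul_le_mul_of_nonneg_left (Real.sqrt_le_sqrt hsq) (Real.sqrt_nonneg _)
  have := mul_le_mul_of_nonneg_left hroot hK
  linarith

/-- [folklore] **NAIVE REWEIGHTING, UPPER SIDE.**  With `∫ (φ − Z (x 0))² dμ ≤ 𝒱` (`|Z| ≤ R`), `|t|·2R ≤ 1`,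
`B > 0`: `∫ g₀(x 0)·e^{tφ} dμ ≤ e^{t²B}·(∫ g₀·e^{tZ} dν + |t|·e^{|t|R}·Cg·√(ν(univ))·√𝒱) + e^{|t|R}·Cg·B⁻¹·𝒱`.
Together with `integral_mul_exp_naive_le_add`: the dressed law's endpoint exponential moments and those of the
naively reweighted undressed law agree up to `O(|t|𝒱^{1/2} + t²B + B⁻¹𝒱)`, all constants displayed. -/
theorem integral_mul_exp_le_naive_of_sqDefect (ν : Measure (X 0)) [IsFiniteMeasure ν] (n : ℕ)
    {φ : (Π k, X k) → ℝ} (hφn : StronglyMeasurable[piLE (X := X) n] φ) {R : ℝ} (hφR : ∀ x, |φ x| ≤ R)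
    {t : ℝ} (ht : |t| * (2 * R) ≤ 1) {B : ℝ} (hB : 0 < B) {Z : X 0 → ℝ} (hZm : StronglyMeasurable Z)
    (hZR : ∀ z, |Z z| ≤ R) {g₀ : X 0 → ℝ} (hg : StronglyMeasurable g₀) (hg0 : ∀ z, 0 ≤ g₀ z) {Cg : ℝ}
    (hCg : 0 ≤ Cg) (hgC : ∀ z, g₀ z ≤ Cg) {𝒱 : ℝ}
    (hV : ∫ x, (φ x - Z (x 0)) ^ 2 ∂(Kernel.trajMeasure ν κ) ≤ 𝒱) :
    ∫ x, g₀ (x 0) * Real.exp (t * φ x) ∂(Kernel.trajMeasure ν κ) ≤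
      Real.exp (t ^ 2 * B) * (∫ z, g₀ z * Real.exp (t * Z z) ∂ν +
          |t| * Real.exp (|t| * R) * Cg * (Real.sqrt (ν.real Set.univ) * Real.sqrt 𝒱)) +
        Real.exp (|t| * R) * (Cg * (B⁻¹ * 𝒱)) := by
  have hφm : StronglyMeasurable φ := hφn.mono ((piLE (X := X)).le n)
  have hgabs : ∀ z, |g₀ z| ≤ Cg := fun z => abs_le.mpr ⟨by linarith [hg0 z, hgC z], hgC z⟩
  have hmain := integral_mul_exp_le_of_sqDefect ν n hφn hφR ht hB hg hg0 hCg hgC hZm hZR hV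
  have hcmp := integral_mul_exp_le_add_of_sq (μ := ν) (stronglyMeasurable_towerMean (κ := κ) hφm) hZm hg
    (abs_towerMean_le hφm hφR) hZR hCg hgabs t
  have hsq : ∫ z, (towerMean κ φ z - Z z) ^ 2 ∂ν ≤ 𝒱 := (integral_sq_towerMean_sub_le ν hφm hφR hZm hZR).trans hV
  have hK : 0 ≤ |t| * Real.exp (|t| * R) * Cg := mul_nonneg (mul_nonneg (abs_nonneg _) (Real.exp_pos _).le) hCg
  have hroot : Real.sqrt (ν.real Set.univ) * Real.sqrt (∫ z, (towerMean κ φ z - Z z) ^ 2 ∂ν) ≤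
      Real.sqrt (ν.real Set.univ) * Real.sqrt 𝒱 :=
    mul_le_mul_of_nonneg_left (Real.sqrt_le_sqrt hsq) (Real.sqrt_nonneg _)
  have h2 : ∫ z, g₀ z * Real.exp (t * towerMean κ φ z) ∂ν ≤ ∫ z, g₀ z * Real.exp (t * Z z) ∂ν +
      |t| * Real.exp (|t| * R) * Cg * (Real.sqrt (ν.real Set.univ) * Real.sqrt 𝒱) :=
    hcmp.trans (add_le_add le_rfl (mul_le_mul_of_nonneg_left hroot hK))
  exact hmain.trans (add_le_add (mul_le_mul_of_nonneg_left h2 (Real.exp_pos _).le) le_rfl)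

/-- [folklore] **THE LADDER BOUND FOR THE ONE NUMBER** (any finite path law).  For bounded measurable `φ`, bounded
measurable PREDICTABLE CENTRES `Zb b (x≤b)` (`b ≤ n`) and sizes `a b ≥ 0` with per-step mean-square increments
`∫ (Zb (b+1) (x≤(b+1)) − Zb b (x≤b))² dμ ≤ (a b)²` (`b < n`) and a last rung `∫ (φ − Zb n (x≤n))² dμ ≤ (a n)²`:
`∫ (φ − Zb 0 (x≤0))² dμ ≤ (Σ_{b≤n} a b)²`.  (Minkowski; NO orthogonality / decorrelation between the steps is used.)
In the dictionary `Zb b (x≤b) = W_C(avg^b V_{K−b})`, the increments are the unit-scale effects of the single ℝ-steps,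
`Zb K = φ`, and `a K = 0`. -/
theorem integral_sq_sub_le_sq_sum_of_ladder (μ : Measure (Π k, X k)) [IsFiniteMeasure μ] (n : ℕ)
    {φ : (Π k, X k) → ℝ} (hφm : StronglyMeasurable φ) {R : ℝ} (hφR : ∀ x, |φ x| ≤ R)
    {Zb : (b : ℕ) → (Π i : Iic b, X i) → ℝ} (hZm : ∀ b, StronglyMeasurable (Zb b)) {CZ : ℝ}
    (hZb : ∀ b h, |Zb b h| ≤ CZ) {a : ℕ → ℝ} (ha : ∀ b ≤ n, 0 ≤ a b)
    (hstep : ∀ b < n, ∫ x, (Zb (b + 1) (frestrictLe (b + 1) x) - Zb b (frestrictLe b x)) ^ 2 ∂μ ≤ a b ^ 2)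
    (hlast : ∫ x, (φ x - Zb n (frestrictLe n x)) ^ 2 ∂μ ≤ a n ^ 2) :
    ∫ x, (φ x - Zb 0 (frestrictLe 0 x)) ^ 2 ∂μ ≤ (∑ b ∈ range (n + 1), a b) ^ 2 := by
  have hlad := sqrt_integral_sq_sub_le_ladder (μ := μ) n hφm.aestronglyMeasurable (ae_of_all μ hφR)
    (ψ := fun b x => Zb b (frestrictLe b x))
    (fun b _ => ((hZm b).comp_measurable (measurable_frestrictLe b)).aestronglyMeasurable) (Cψ := CZ)
    (fun b _ => ae_of_all μ fun x => hZb b _)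
  have h1 : ∀ b ∈ range n,
      Real.sqrt (∫ x, (Zb (b + 1) (frestrictLe (b + 1) x) - Zb b (frestrictLe b x)) ^ 2 ∂μ) ≤ a b := by
    intro b hb
    have hb' := mem_range.mp hb
    exact (Real.sqrt_le_sqrt (hstep b hb')).trans_eq (Real.sqrt_sq (ha b hb'.le))
  have h2 : Real.sqrt (∫ x, (φ x - Zb n (frestrictLe n x)) ^ 2 ∂μ) ≤ a n :=
    (Real.sqrt_le_sqrt hlast).trans_eq (Real.sqrt_sq (ha n le_rfl))
  have hsum : Real.sqrt (∫ x, (φ x - Zb 0 (frestrictLe 0 x)) ^ 2 ∂μ) ≤ ∑ b ∈ range (n + 1), a b := by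
    rw [sum_range_succ]
    exact hlad.trans (add_le_add (Finset.sum_le_sum h1) h2)
  have h0 : 0 ≤ ∫ x, (φ x - Zb 0 (frestrictLe 0 x)) ^ 2 ∂μ := integral_nonneg fun _ => sq_nonneg _
  calc ∫ x, (φ x - Zb 0 (frestrictLe 0 x)) ^ 2 ∂μ
      = Real.sqrt (∫ x, (φ x - Zb 0 (frestrictLe 0 x)) ^ 2 ∂μ) ^ 2 := (Real.sq_sqrt h0).symm
    _ ≤ (∑ b ∈ range (n + 1), a b) ^ 2 := pow_le_pow_left₀ (Real.sqrt_nonneg _) hsum 2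

/-- [folklore] **END-TO-END FROM THE LADDER (realised chain).**  The hypotheses of `integral_sq_sub_le_sq_sum_of_ladder`
for `μ = trajMeasure ν κ` and a `piLE n`-measurable `φ` give the conclusion of `integral_mul_exp_le_of_condVariance`
with `𝒱 = (Σ_{b≤n} a b)²`. -/
theorem integral_mul_exp_le_of_ladder (ν : Measure (X 0)) [IsFiniteMeasure ν] (n : ℕ)
    {φ : (Π k, X k) → ℝ} (hφn : StronglyMeasurable[piLE (X := X) n] φ) {R : ℝ} (hφR : ∀ x, |φ x| ≤ R)
    {t : ℝ} (ht : |t| * (2 * R) ≤ 1) {B : ℝ} (hB : 0 < B) {g₀ : X 0 → ℝ} (hg : StronglyMeasurable g₀)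
    (hg0 : ∀ z, 0 ≤ g₀ z) {Cg : ℝ} (hCg : 0 ≤ Cg) (hgC : ∀ z, g₀ z ≤ Cg)
    {Zb : (b : ℕ) → (Π i : Iic b, X i) → ℝ} (hZm : ∀ b, StronglyMeasurable (Zb b)) {CZ : ℝ}
    (hZb : ∀ b h, |Zb b h| ≤ CZ) {a : ℕ → ℝ} (ha : ∀ b ≤ n, 0 ≤ a b)
    (hstep : ∀ b < n, ∫ x, (Zb (b + 1) (frestrictLe (b + 1) x) - Zb b (frestrictLe b x)) ^ 2
      ∂(Kernel.trajMeasure ν κ) ≤ a b ^ 2)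
    (hlast : ∫ x, (φ x - Zb n (frestrictLe n x)) ^ 2 ∂(Kernel.trajMeasure ν κ) ≤ a n ^ 2) :
    ∫ x, g₀ (x 0) * Real.exp (t * φ x) ∂(Kernel.trajMeasure ν κ) ≤
      Real.exp (t ^ 2 * B) * ∫ z, g₀ z * Real.exp (t * towerMean κ φ z) ∂ν +
        Real.exp (|t| * R) * (Cg * (B⁻¹ * (∑ b ∈ range (n + 1), a b) ^ 2)) := by
  have hφm : StronglyMeasurable φ := hφn.mono ((piLE (X := X)).le n)
  have hlad := integral_sq_sub_le_sq_sum_of_ladder (Kernel.trajMeasure ν κ) n hφm hφR hZm hZb ha hstep hlast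
  have hZ0 : StronglyMeasurable (fun z : X 0 => Zb 0 (endpointHistory z)) :=
    (hZm 0).comp_measurable measurable_endpointHistory
  have heq : ∫ x, (φ x - Zb 0 (endpointHistory (x 0))) ^ 2 ∂(Kernel.trajMeasure ν κ) =
      ∫ x, (φ x - Zb 0 (frestrictLe 0 x)) ^ 2 ∂(Kernel.trajMeasure ν κ) :=
    integral_congr_ae (ae_of_all _ fun x => by simp only [frestrictLe_zero_eq_endpointHistory])
  exact integral_mul_exp_le_of_sqDefect ν n hφn hφR ht hB hg hg0 hCg hgC hZ0 (CZ := CZ) (fun z => hZb 0 _)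
    (heq.trans_le hlad)

end ChainVariance

/-! ## §4  The same for an ARBITRARY finite path law (posterior kernels) — the consumable forms -/

section PathLaw

variable {X : ℕ → Type*} [∀ n, MeasurableSpace (X n)] [∀ n, StandardBorelSpace (X n)] [∀ n, Nonempty (X n)]

/-- [folklore] **THE VARIANCE IDENTITY FOR AN ARBITRARY PATH LAW**: with `κ := posteriorKernel μ`,
`Σ_{b<n} ∫ oneStepVar κ b φ (x≤b) dμ = ∫ (φ − towerMean κ φ (x 0))² dμ`. -/
theorem sum_integral_oneStepVar_eq_pathLaw (μ : Measure (Π n, X n)) [IsFiniteMeasure μ] (n : ℕ)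
    {φ : (Π k, X k) → ℝ} (hφn : StronglyMeasurable[piLE (X := X) n] φ) {R : ℝ} (hφR : ∀ x, |φ x| ≤ R) :
    ∑ b ∈ range n, ∫ x, oneStepVar (posteriorKernel μ) b φ (frestrictLe b x) ∂μ =
      ∫ x, (φ x - towerMean (posteriorKernel μ) φ (x 0)) ^ 2 ∂μ := by
  have h := sum_integral_oneStepVar_eq (κ := posteriorKernel μ) (μ.map (fun x => x 0)) n hφn hφR
  rwa [trajMeasure_posteriorKernel_eq μ] at h

/-- [folklore] **THE ENDPOINT DEFECT DOMINATES THE CONDITIONAL VARIANCE (arbitrary path law).** -/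
theorem integral_sq_sub_towerMean_le_pathLaw (μ : Measure (Π n, X n)) [IsFiniteMeasure μ]
    {φ : (Π k, X k) → ℝ} (hφm : StronglyMeasurable φ) {R : ℝ} (hφR : ∀ x, |φ x| ≤ R) {Z : X 0 → ℝ}
    (hZm : StronglyMeasurable Z) {CZ : ℝ} (hZb : ∀ z, |Z z| ≤ CZ) :
    ∫ x, (φ x - towerMean (posteriorKernel μ) φ (x 0)) ^ 2 ∂μ ≤ ∫ x, (φ x - Z (x 0)) ^ 2 ∂μ := by
  have h := integral_sq_sub_towerMean_le (κ := posteriorKernel μ) (μ.map (fun x => x 0)) hφm hφR hZm hZb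
  rwa [trajMeasure_posteriorKernel_eq μ] at h

/-- [folklore] **END-TO-END FROM THE ENDPOINT DEFECT FOR AN ARBITRARY PATH LAW** — the consumable form of MI-V.
For a finite law `μ` on `Π n, X n` (standard Borel, non-empty carriers), a bounded `piLE n`-measurable `φ`,
`|t|·2R ≤ 1`, `B > 0`, `0 ≤ g₀ ≤ Cg` measurable, ANY bounded measurable `Z : X 0 → ℝ` and
`∫ (φ − Z (x 0))² dμ ≤ 𝒱`:
`∫ g₀(x 0)·e^{tφ} dμ ≤ e^{t²B}·∫ g₀(x 0)·e^{t·towerMean (posteriorKernel μ) φ (x 0)} dμ + e^{|t|R}·Cg·B⁻¹·𝒱`. -/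
theorem integral_mul_exp_le_of_sqDefect_pathLaw (μ : Measure (Π n, X n)) [IsFiniteMeasure μ] (n : ℕ)
    {φ : (Π k, X k) → ℝ} (hφn : StronglyMeasurable[piLE (X := X) n] φ) {R : ℝ} (hφR : ∀ x, |φ x| ≤ R)
    {t : ℝ} (ht : |t| * (2 * R) ≤ 1) {B : ℝ} (hB : 0 < B) {g₀ : X 0 → ℝ} (hg : StronglyMeasurable g₀)
    (hg0 : ∀ z, 0 ≤ g₀ z) {Cg : ℝ} (hCg : 0 ≤ Cg) (hgC : ∀ z, g₀ z ≤ Cg)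
    {Z : X 0 → ℝ} (hZm : StronglyMeasurable Z) {CZ : ℝ} (hZb : ∀ z, |Z z| ≤ CZ) {𝒱 : ℝ}
    (hV : ∫ x, (φ x - Z (x 0)) ^ 2 ∂μ ≤ 𝒱) :
    ∫ x, g₀ (x 0) * Real.exp (t * φ x) ∂μ ≤
      Real.exp (t ^ 2 * B) * ∫ x, g₀ (x 0) * Real.exp (t * towerMean (posteriorKernel μ) φ (x 0)) ∂μ +
        Real.exp (|t| * R) * (Cg * (B⁻¹ * 𝒱)) := by
  have hφm : StronglyMeasurable φ := hφn.mono ((piLE (X := X)).le n)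
  have h := integral_mul_exp_le_of_sqDefect (κ := posteriorKernel μ) (μ.map (fun x => x 0)) n hφn hφR ht hB
    hg hg0 hCg hgC hZm hZb (𝒱 := 𝒱) (by rw [trajMeasure_posteriorKernel_eq μ]; exact hV)
  rw [trajMeasure_posteriorKernel_eq μ] at h
  have hGm : AEStronglyMeasurable (fun z : X 0 => g₀ z * Real.exp (t * towerMean (posteriorKernel μ) φ z))
      (μ.map (fun x => x 0)) :=
    (Measurable.mul (f := g₀) (g := fun z => Real.exp (t * towerMean (posteriorKernel μ) φ z)) hg.measurable
      (Real.measurable_exp.comp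
        ((stronglyMeasurable_towerMean (κ := posteriorKernel μ) hφm).measurable.const_mul t))).aestronglyMeasurable
  rw [integral_map (measurable_pi_apply 0).aemeasurable hGm] at h
  exact h

/-- [folklore] **NAIVE REWEIGHTING FOR AN ARBITRARY PATH LAW, both sides.**  With `|Z| ≤ R` and
`∫ (φ − Z (x 0))² dμ ≤ 𝒱`: (lower) `∫ g₀(x 0)·e^{tZ(x 0)} dμ ≤ ∫ g₀(x 0)·e^{tφ} dμ + |t|e^{|t|R}Cg·√(μ(univ))·√𝒱`;
(upper) `∫ g₀(x 0)·e^{tφ} dμ ≤ e^{t²B}·(∫ g₀(x 0)·e^{tZ(x 0)} dμ + |t|e^{|t|R}Cg·√(μ(univ))·√𝒱) + e^{|t|R}Cg·B⁻¹·𝒱`.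
In the dictionary: the dressed density's unit-lattice exponential moments of `W_C(avg^K V_0)` against the naively
reweighted undressed ones `e^{tW_C}ρ_K`, with every constant displayed and free of `K` GIVEN (MI-V). -/
theorem integral_mul_exp_naive_bounds_pathLaw (μ : Measure (Π n, X n)) [IsFiniteMeasure μ] (n : ℕ)
    {φ : (Π k, X k) → ℝ} (hφn : StronglyMeasurable[piLE (X := X) n] φ) {R : ℝ} (hφR : ∀ x, |φ x| ≤ R)
    {t : ℝ} (ht : |t| * (2 * R) ≤ 1) {B : ℝ} (hB : 0 < B) {Z : X 0 → ℝ} (hZm : StronglyMeasurable Z)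
    (hZR : ∀ z, |Z z| ≤ R) {g₀ : X 0 → ℝ} (hg : StronglyMeasurable g₀) (hg0 : ∀ z, 0 ≤ g₀ z) {Cg : ℝ}
    (hCg : 0 ≤ Cg) (hgC : ∀ z, g₀ z ≤ Cg) {𝒱 : ℝ} (hV : ∫ x, (φ x - Z (x 0)) ^ 2 ∂μ ≤ 𝒱) :
    ∫ x, g₀ (x 0) * Real.exp (t * Z (x 0)) ∂μ ≤ ∫ x, g₀ (x 0) * Real.exp (t * φ x) ∂μ +
        |t| * Real.exp (|t| * R) * Cg * (Real.sqrt (μ.real Set.univ) * Real.sqrt 𝒱) ∧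
      ∫ x, g₀ (x 0) * Real.exp (t * φ x) ∂μ ≤
        Real.exp (t ^ 2 * B) * (∫ x, g₀ (x 0) * Real.exp (t * Z (x 0)) ∂μ +
            |t| * Real.exp (|t| * R) * Cg * (Real.sqrt (μ.real Set.univ) * Real.sqrt 𝒱)) +
          Real.exp (|t| * R) * (Cg * (B⁻¹ * 𝒱)) := by
  have hlo := integral_mul_exp_naive_le_add (κ := posteriorKernel μ) (μ.map (fun x => x 0)) n hφn hφR hZm hZR
    hg hg0 hCg hgC t (𝒱 := 𝒱) (by rw [trajMeasure_posteriorKernel_eq μ]; exact hV)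
  have hup := integral_mul_exp_le_naive_of_sqDefect (κ := posteriorKernel μ) (μ.map (fun x => x 0)) n hφn hφR
    ht hB hZm hZR hg hg0 hCg hgC (𝒱 := 𝒱) (by rw [trajMeasure_posteriorKernel_eq μ]; exact hV)
  have hmass : (μ.map (fun x => x 0)).real Set.univ = μ.real Set.univ := by
    have hm := measureReal_univ_trajMeasure (κ := posteriorKernel μ) (μ.map (fun x => x 0))
    rw [trajMeasure_posteriorKernel_eq μ] at hm
    exact hm.symm
  rw [trajMeasure_posteriorKernel_eq μ] at hlo hup
  rw [hmass] at hlo hup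
  have hGm : AEStronglyMeasurable (fun z : X 0 => g₀ z * Real.exp (t * Z z)) (μ.map (fun x => x 0)) :=
    (Measurable.mul (f := g₀) (g := fun z => Real.exp (t * Z z)) hg.measurable
      (Real.measurable_exp.comp (hZm.measurable.const_mul t))).aestronglyMeasurable
  rw [integral_map (measurable_pi_apply 0).aemeasurable hGm] at hlo hup
  exact ⟨hlo, hup⟩

/-- [folklore] **END-TO-END FROM THE LADDER FOR AN ARBITRARY PATH LAW** — the consumable form of MI-Δ: predictable
bounded measurable centres `Zb b (x≤b)`, sizes `a b ≥ 0`, per-step mean-square increments `≤ (a b)²` and a last rung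
`∫ (φ − Zb n (x≤n))² dμ ≤ (a n)²` give the conclusion of `integral_mul_exp_le_of_sqDefect_pathLaw` with
`𝒱 = (Σ_{b≤n} a b)²`. -/
theorem integral_mul_exp_le_of_ladder_pathLaw (μ : Measure (Π n, X n)) [IsFiniteMeasure μ] (n : ℕ)
    {φ : (Π k, X k) → ℝ} (hφn : StronglyMeasurable[piLE (X := X) n] φ) {R : ℝ} (hφR : ∀ x, |φ x| ≤ R)
    {t : ℝ} (ht : |t| * (2 * R) ≤ 1) {B : ℝ} (hB : 0 < B) {g₀ : X 0 → ℝ} (hg : StronglyMeasurable g₀)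
    (hg0 : ∀ z, 0 ≤ g₀ z) {Cg : ℝ} (hCg : 0 ≤ Cg) (hgC : ∀ z, g₀ z ≤ Cg)
    {Zb : (b : ℕ) → (Π i : Iic b, X i) → ℝ} (hZm : ∀ b, StronglyMeasurable (Zb b)) {CZ : ℝ}
    (hZb : ∀ b h, |Zb b h| ≤ CZ) {a : ℕ → ℝ} (ha : ∀ b ≤ n, 0 ≤ a b)
    (hstep : ∀ b < n, ∫ x, (Zb (b + 1) (frestrictLe (b + 1) x) - Zb b (frestrictLe b x)) ^ 2 ∂μ ≤ a b ^ 2)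
    (hlast : ∫ x, (φ x - Zb n (frestrictLe n x)) ^ 2 ∂μ ≤ a n ^ 2) :
    ∫ x, g₀ (x 0) * Real.exp (t * φ x) ∂μ ≤
      Real.exp (t ^ 2 * B) * ∫ x, g₀ (x 0) * Real.exp (t * towerMean (posteriorKernel μ) φ (x 0)) ∂μ +
        Real.exp (|t| * R) * (Cg * (B⁻¹ * (∑ b ∈ range (n + 1), a b) ^ 2)) := by
  have hφm : StronglyMeasurable φ := hφn.mono ((piLE (X := X)).le n)
  have hlad := integral_sq_sub_le_sq_sum_of_ladder μ n hφm hφR hZm hZb ha hstep hlast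
  have hZ0 : StronglyMeasurable (fun z : X 0 => Zb 0 (endpointHistory z)) :=
    (hZm 0).comp_measurable measurable_endpointHistory
  have heq : ∫ x, (φ x - Zb 0 (endpointHistory (x 0))) ^ 2 ∂μ = ∫ x, (φ x - Zb 0 (frestrictLe 0 x)) ^ 2 ∂μ :=
    integral_congr_ae (ae_of_all _ fun x => by simp only [frestrictLe_zero_eq_endpointHistory])
  exact integral_mul_exp_le_of_sqDefect_pathLaw μ n hφn hφR ht hB hg hg0 hCg hgC hZ0 (CZ := CZ)
    (fun z => hZb 0 _) (heq.trans_le hlad)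

end PathLaw

/-! ## §5  MI-V IN ONE-STEP SECOND-MOMENT CURRENCY: free predictable centres (v2)

The identity of §2 presents the conditional variance of `φ` given the endpoint as the accumulated one-step
VARIANCES of the conditional means (centre = the one-step conditional mean `fiberMean κ b φ h`, the martingale
centre).  A print-side consumer rarely controls the conditional mean itself; it controls the deviation of the
level-`(b+1)` conditional mean from SOME predictable proxy `ctr b h` (the value suggested by the deterministic part
of the step: the minimiser / the small-field saddle, with the printed localized corrections folded in).  Since the
variance about the mean is the least second moment about any constant, MI-V is bounded by the accumulated ONE-STEP
SECOND MOMENTS about free predictable centres: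
`∫ (φ − towerMean κ φ (x 0))² dμ ≤ Σ_{b<n} ∫ [∫ (fiberMean κ (b+1) φ u − ctr b (x≤b))² d(partialTraj κ b (b+1) (x≤b))(u)] dμ`,
with equality for `ctr b = fiberMean κ b φ`.  Each summand is an integral, over histories, of a ONE-STEP quantity:
the second moment, under ONE draw `u ∼ κ b (x≤b)` of the fresh level, of the deviation of the new conditional mean
from the proxy.  This is the currency in which the incoherence mechanism lives (under a one-step law that is a
product over conditionally independent components and an additively separating deviation, the one-step second
moment about the right centre is the SUM of the per-component ones — Bienaymé; not formalised here), and in which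
no conditional ranks, no product domination and no factorisation hypothesis of the gen-3/4 routes are needed: the
consumer bounds `Σ_b E[oneStepSqDev_b]` by whatever means and feeds the number to §2/§4. -/

section OneStepSecondMoment

variable {X : ℕ → Type*} [∀ n, MeasurableSpace (X n)]
variable {κ : (b : ℕ) → Kernel (Π i : Iic b, X i) (X (b + 1))} [∀ b, IsMarkovKernel (κ b)]

/-- [folklore] **VARIANCE ≤ SECOND MOMENT ABOUT ANY CONSTANT (one step).**  For bounded measurable `φ`, every history
`h` and every `a : ℝ`:
`oneStepVar κ b φ h ≤ ∫ (fiberMean κ (b+1) φ u − a)² d(partialTraj κ b (b+1) h)(u)`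
(indeed `= oneStepVar + (fiberMean κ b φ h − a)²`, the one-step mean of `fiberMean κ (b+1) φ` being `fiberMean κ b φ h`). -/
theorem oneStepVar_le_integral_sq_sub_const (b : ℕ) {φ : (Π n, X n) → ℝ} (hφm : StronglyMeasurable φ) {R : ℝ}
    (hφR : ∀ x, |φ x| ≤ R) (h : Π i : Iic b, X i) (a : ℝ) :
    oneStepVar κ b φ h ≤ ∫ u, (fiberMean κ (b + 1) φ u - a) ^ 2 ∂(Kernel.partialTraj κ b (b + 1) h) := by
  set P := Kernel.partialTraj κ b (b + 1) h with hP
  set F : (Π i : Iic (b + 1), X i) → ℝ := fiberMean κ (b + 1) φ with hF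
  set m : ℝ := fiberMean κ b φ h with hm
  have hFm : StronglyMeasurable F := stronglyMeasurable_fiberMean _ hφm
  have hFR : ∀ u, |F u| ≤ R := fun u => abs_fiberMean_le _ hφm hφR u
  have hFi : Integrable F P := integrable_of_abs_le_const hFm hFR
  have hmean : ∫ u, F u ∂P = m := (fiberMean_eq_integral_partialTraj (κ := κ) b hφm hφR h).symm
  have hsm : StronglyMeasurable (fun u => (F u - m) ^ 2) := (hFm.sub stronglyMeasurable_const).pow 2
  have hA : Integrable (fun u => (F u - m) ^ 2) P :=
    integrable_of_abs_le_const (φ := fun u => (F u - m) ^ 2) (R := (R + |m|) ^ 2) hsm fun u => by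
      have h1 : |F u - m| ≤ R + |m| := (abs_sub _ _).trans (add_le_add (hFR u) le_rfl)
      have h2 : |(F u - m) ^ 2| = |F u - m| ^ 2 := abs_pow _ 2
      rw [h2]
      exact pow_le_pow_left₀ (abs_nonneg _) h1 2
  have hB : Integrable (fun u => F u - m) P := hFi.sub (integrable_const _)
  have hexp : (fun u => (F u - a) ^ 2) =
      fun u => ((F u - m) ^ 2 + (m - a) ^ 2) + (2 * (m - a)) * (F u - m) := by
    funext u; ring
  have hAB : Integrable (fun u => (F u - m) ^ 2 + (m - a) ^ 2) P := hA.add (integrable_const _)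
  have hzero : ∫ u, (F u - m) ∂P = 0 := by
    rw [integral_sub hFi (integrable_const _), hmean, integral_const]
    simp
  show ∫ u, (F u - m) ^ 2 ∂P ≤ ∫ u, (F u - a) ^ 2 ∂P
  rw [hexp, integral_add hAB (hB.const_mul _), integral_add hA (integrable_const _), integral_const_mul, hzero,
    mul_zero, add_zero, integral_const]
  simp only [probReal_univ, smul_eq_mul, one_mul]
  exact le_add_of_nonneg_right (sq_nonneg _)

/-- [folklore] The ONE-STEP SECOND MOMENT of the new conditional mean about a predictable centre `ctr`:
`oneStepSqDev κ b φ ctr h := ∫ (fiberMean κ (b+1) φ u − ctr h)² d(partialTraj κ b (b+1) h)(u)` is a measurable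
function of the history. -/
theorem stronglyMeasurable_integral_sq_fiberMean_sub (b : ℕ) {φ : (Π n, X n) → ℝ} (hφm : StronglyMeasurable φ)
    {ctr : (Π i : Iic b, X i) → ℝ} (hcm : StronglyMeasurable ctr) :
    StronglyMeasurable fun h : Π i : Iic b, X i =>
      ∫ u, (fiberMean κ (b + 1) φ u - ctr h) ^ 2 ∂(Kernel.partialTraj κ b (b + 1) h) := by
  have hψ1 : StronglyMeasurable (fiberMean κ (b + 1) φ) := stronglyMeasurable_fiberMean _ hφm
  have hF : StronglyMeasurable (uncurry fun (h : Π i : Iic b, X i) (u : Π i : Iic (b + 1), X i) =>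
      (fiberMean κ (b + 1) φ u - ctr h) ^ 2) :=
    ((hψ1.comp_measurable measurable_snd).sub (hcm.comp_measurable measurable_fst)).pow 2
  exact hF.integral_kernel_prod_right (κ := Kernel.partialTraj κ b (b + 1))

/-- [folklore] The one-step second moment about a centre bounded by `Cc` is bounded by `(R + Cc)²`. -/
theorem integral_sq_fiberMean_sub_le (b : ℕ) {φ : (Π n, X n) → ℝ} (hφm : StronglyMeasurable φ) {R : ℝ}
    (hφR : ∀ x, |φ x| ≤ R) {ctr : (Π i : Iic b, X i) → ℝ} {Cc : ℝ} (hcb : ∀ h, |ctr h| ≤ Cc)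
    (h : Π i : Iic b, X i) :
    ∫ u, (fiberMean κ (b + 1) φ u - ctr h) ^ 2 ∂(Kernel.partialTraj κ b (b + 1) h) ≤ (R + Cc) ^ 2 := by
  have hpt : ∀ u, (fiberMean κ (b + 1) φ u - ctr h) ^ 2 ≤ (R + Cc) ^ 2 := fun u => by
    have hu : |fiberMean κ (b + 1) φ u - ctr h| ≤ R + Cc :=
      (abs_sub _ _).trans (add_le_add (abs_fiberMean_le _ hφm hφR u) (hcb h))
    exact sq_le_sq' ((abs_le.mp hu).1) ((abs_le.mp hu).2)
  calc _ ≤ ∫ _, (R + Cc) ^ 2 ∂(Kernel.partialTraj κ b (b + 1) h) :=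
        integral_mono_of_nonneg (ae_of_all _ fun _ => sq_nonneg _) (integrable_const _) (ae_of_all _ hpt)
    _ = (R + Cc) ^ 2 := by simp

/-- [folklore] **MI-V ≤ THE ACCUMULATED ONE-STEP SECOND MOMENTS ABOUT FREE PREDICTABLE CENTRES.**  On a realised
chain, for bounded `φ` measurable with respect to the levels `≤ n` and ANY family of bounded measurable centres
`ctr b : (levels ≤ b) → ℝ`:
`∫ (φ − towerMean κ φ (x 0))² dμ ≤ Σ_{b<n} ∫ [∫ (fiberMean κ (b+1) φ u − ctr b (x≤b))² d(partialTraj κ b (b+1) (x≤b))(u)] dμ`.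
(`sum_integral_oneStepVar_eq` + `oneStepVar_le_integral_sq_sub_const` termwise.)  In the dictionary: the left
side is MI-V's number; the `b`-th summand is the mean, over undressed histories, of the second moment — under ONE
step of the fine-to-coarse conditional law — of the deviation of the new conditional mean of the dressing
observable from the consumer's predictable proxy. -/
theorem integral_sq_sub_towerMean_le_sum_oneStepSqDev (ν : Measure (X 0)) [IsFiniteMeasure ν] (n : ℕ)
    {φ : (Π k, X k) → ℝ} (hφn : StronglyMeasurable[piLE (X := X) n] φ) {R : ℝ} (hφR : ∀ x, |φ x| ≤ R)
    {ctr : (b : ℕ) → (Π i : Iic b, X i) → ℝ} (hcm : ∀ b, StronglyMeasurable (ctr b)) {Cc : ℝ}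
    (hcb : ∀ b h, |ctr b h| ≤ Cc) :
    ∫ x, (φ x - towerMean κ φ (x 0)) ^ 2 ∂(Kernel.trajMeasure ν κ) ≤
      ∑ b ∈ range n, ∫ x, (∫ u, (fiberMean κ (b + 1) φ u - ctr b (frestrictLe b x)) ^ 2
        ∂(Kernel.partialTraj κ b (b + 1) (frestrictLe b x))) ∂(Kernel.trajMeasure ν κ) := by
  have hφm : StronglyMeasurable φ := hφn.mono ((piLE (X := X)).le n)
  rw [← sum_integral_oneStepVar_eq (κ := κ) ν n hφn hφR]
  refine Finset.sum_le_sum fun b _ => ?_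
  refine integral_mono ?_ ?_ fun x => oneStepVar_le_integral_sq_sub_const (κ := κ) b hφm hφR _ _
  · exact integrable_of_abs_le_const
      ((stronglyMeasurable_oneStepVar (κ := κ) b hφm).comp_measurable (measurable_frestrictLe b))
      fun x => abs_oneStepVar_le (κ := κ) b hφm hφR _
  · refine integrable_of_abs_le_const
      ((stronglyMeasurable_integral_sq_fiberMean_sub (κ := κ) b hφm (hcm b)).comp_measurable
        (measurable_frestrictLe b)) (R := (R + Cc) ^ 2) fun x => ?_
    rw [abs_of_nonneg (integral_nonneg fun _ => sq_nonneg _)]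
    exact integral_sq_fiberMean_sub_le (κ := κ) b hφm hφR (hcb b) _

/-- [folklore] **END-TO-END FROM ONE-STEP SECOND MOMENTS (realised chain).**  If the accumulated one-step second
moments about some bounded predictable centres are `≤ 𝒱`, the dressed exponential-moment bound of
`integral_mul_exp_le_of_condVariance` holds with that `𝒱`. -/
theorem integral_mul_exp_le_of_oneStepSqDev (ν : Measure (X 0)) [IsFiniteMeasure ν] (n : ℕ)
    {φ : (Π k, X k) → ℝ} (hφn : StronglyMeasurable[piLE (X := X) n] φ) {R : ℝ} (hφR : ∀ x, |φ x| ≤ R)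
    {t : ℝ} (ht : |t| * (2 * R) ≤ 1) {B : ℝ} (hB : 0 < B) {g₀ : X 0 → ℝ} (hg : StronglyMeasurable g₀)
    (hg0 : ∀ z, 0 ≤ g₀ z) {Cg : ℝ} (hCg : 0 ≤ Cg) (hgC : ∀ z, g₀ z ≤ Cg)
    {ctr : (b : ℕ) → (Π i : Iic b, X i) → ℝ} (hcm : ∀ b, StronglyMeasurable (ctr b)) {Cc : ℝ}
    (hcb : ∀ b h, |ctr b h| ≤ Cc) {𝒱 : ℝ}
    (hV : ∑ b ∈ range n, ∫ x, (∫ u, (fiberMean κ (b + 1) φ u - ctr b (frestrictLe b x)) ^ 2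
        ∂(Kernel.partialTraj κ b (b + 1) (frestrictLe b x))) ∂(Kernel.trajMeasure ν κ) ≤ 𝒱) :
    ∫ x, g₀ (x 0) * Real.exp (t * φ x) ∂(Kernel.trajMeasure ν κ) ≤
      Real.exp (t ^ 2 * B) * ∫ z, g₀ z * Real.exp (t * towerMean κ φ z) ∂ν +
        Real.exp (|t| * R) * (Cg * (B⁻¹ * 𝒱)) :=
  integral_mul_exp_le_of_condVariance (κ := κ) ν n hφn hφR ht hB hg hg0 hCg hgC
    ((integral_sq_sub_towerMean_le_sum_oneStepSqDev (κ := κ) ν n hφn hφR hcm hcb).trans hV)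

end OneStepSecondMoment

section OneStepSecondMomentPathLaw

variable {X : ℕ → Type*} [∀ n, MeasurableSpace (X n)] [∀ n, StandardBorelSpace (X n)] [∀ n, Nonempty (X n)]

/-- [folklore] **MI-V ≤ ACCUMULATED ONE-STEP SECOND MOMENTS, arbitrary path law** (`κ := posteriorKernel μ`, the
backward one-step conditional laws of `μ`). -/
theorem integral_sq_sub_towerMean_le_sum_oneStepSqDev_pathLaw (μ : Measure (Π n, X n)) [IsFiniteMeasure μ] (n : ℕ)
    {φ : (Π k, X k) → ℝ} (hφn : StronglyMeasurable[piLE (X := X) n] φ) {R : ℝ} (hφR : ∀ x, |φ x| ≤ R)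
    {ctr : (b : ℕ) → (Π i : Iic b, X i) → ℝ} (hcm : ∀ b, StronglyMeasurable (ctr b)) {Cc : ℝ}
    (hcb : ∀ b h, |ctr b h| ≤ Cc) :
    ∫ x, (φ x - towerMean (posteriorKernel μ) φ (x 0)) ^ 2 ∂μ ≤
      ∑ b ∈ range n, ∫ x, (∫ u, (fiberMean (posteriorKernel μ) (b + 1) φ u - ctr b (frestrictLe b x)) ^ 2
        ∂(Kernel.partialTraj (posteriorKernel μ) b (b + 1) (frestrictLe b x))) ∂μ := by
  have h := integral_sq_sub_towerMean_le_sum_oneStepSqDev (κ := posteriorKernel μ) (μ.map (fun x => x 0)) n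
    hφn hφR hcm hcb
  rwa [trajMeasure_posteriorKernel_eq μ] at h

/-- [folklore] **END-TO-END FROM ONE-STEP SECOND MOMENTS, arbitrary path law.**  With `κ := posteriorKernel μ`: if
`Σ_{b<n} ∫ [∫ (fiberMean κ (b+1) φ u − ctr b (x≤b))² d(partialTraj κ b (b+1) (x≤b))(u)] dμ ≤ 𝒱` for some bounded
measurable predictable centres, then for `|t|·2R ≤ 1`, `B > 0`, `0 ≤ g₀ ≤ Cg`:
`∫ g₀(x 0)·e^{tφ} dμ ≤ e^{t²B}·∫ g₀(x 0)·e^{t·towerMean κ φ (x 0)} dμ + e^{|t|R}·Cg·B⁻¹·𝒱`. -/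
theorem integral_mul_exp_le_of_oneStepSqDev_pathLaw (μ : Measure (Π n, X n)) [IsFiniteMeasure μ] (n : ℕ)
    {φ : (Π k, X k) → ℝ} (hφn : StronglyMeasurable[piLE (X := X) n] φ) {R : ℝ} (hφR : ∀ x, |φ x| ≤ R)
    {t : ℝ} (ht : |t| * (2 * R) ≤ 1) {B : ℝ} (hB : 0 < B) {g₀ : X 0 → ℝ} (hg : StronglyMeasurable g₀)
    (hg0 : ∀ z, 0 ≤ g₀ z) {Cg : ℝ} (hCg : 0 ≤ Cg) (hgC : ∀ z, g₀ z ≤ Cg)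
    {ctr : (b : ℕ) → (Π i : Iic b, X i) → ℝ} (hcm : ∀ b, StronglyMeasurable (ctr b)) {Cc : ℝ}
    (hcb : ∀ b h, |ctr b h| ≤ Cc) {𝒱 : ℝ}
    (hV : ∑ b ∈ range n, ∫ x, (∫ u, (fiberMean (posteriorKernel μ) (b + 1) φ u - ctr b (frestrictLe b x)) ^ 2
        ∂(Kernel.partialTraj (posteriorKernel μ) b (b + 1) (frestrictLe b x))) ∂μ ≤ 𝒱) :
    ∫ x, g₀ (x 0) * Real.exp (t * φ x) ∂μ ≤
      Real.exp (t ^ 2 * B) * ∫ x, g₀ (x 0) * Real.exp (t * towerMean (posteriorKernel μ) φ (x 0)) ∂μ +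
        Real.exp (|t| * R) * (Cg * (B⁻¹ * 𝒱)) :=
  integral_mul_exp_le_of_sqDefect_pathLaw μ n hφn hφR ht hB hg hg0 hCg hgC
    (stronglyMeasurable_towerMean (κ := posteriorKernel μ) (hφn.mono ((piLE (X := X)).le n)))
    (fun z => abs_towerMean_le (κ := posteriorKernel μ) (hφn.mono ((piLE (X := X)).le n)) hφR z)
    ((integral_sq_sub_towerMean_le_sum_oneStepSqDev_pathLaw μ n hφn hφR hcm hcb).trans hV)

end OneStepSecondMomentPathLaw

end Literature.MathematicalPhysics.QuantumFieldTheory.Balaban1983to89.T4CouplingVariance
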